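import Literature.MathematicalPhysics.QuantumFieldTheory.Balaban1983to89.B4TorusBoxReindex
import Literature.MathematicalPhysics.QuantumFieldTheory.Balaban1983to89.B2Prop22RegularTorusPair

/-!
# `Balaban1983to89.B4ThmTorusBox` — [Balaban1983RegularityDecay] THEOREM p. 573, (1.9)–(1.12), «WITHOUT ANY
# RESTRICTIONS ON THE POINTS x, x′» FOR PROPER PARALLELEPIPEDS `Ω` OF THE TORUS `T_η` (with `Ω₀ = T_η`), AT A
# (1.7)-REGULAR TORUS FIELD, IN THE TYPED `η`-UNIFORM FORM `ThmPrintedNN` — the family `torusBoxFam` (`rect := True`)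

statement-level skeleton of published theorems with citation tags; proofs where landed; nothing here is a claim about the Yang–Mills mass gap

CITATION HEADER.  T. Bałaban, *Regularity and decay of lattice Green's functions*, Commun. Math. Phys. **89** (1983)
571–597, doi:10.1007/bf01214744 [Balaban1983RegularityDecay] (cell paper B4; held text
`paper:balaban1983-cmp89-regularity-decay`, journal page = PDF page + 570; p. 572 (1.1)–(1.7), p. 573 Theorem
(1.9)–(1.12) with its last sentence).  Cell `pub-ymgap`, Track-A seat `pub-ymgap-dag-p3` gen 3 (node N01 of YM-PLAN §2;
payload OPS-REQUESTS l.312 § dag-p3; house rules R415; INTENT-3 INBOX l.8866).  File 2 of 2 of the `rect`-residual (α)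
programme (INBOX l.8760 (2)(i); file 1 = `B4TorusBoxReindex`, p407535).  USED BY NAME, never restated: b04's
`B4.{EtaSetting, Ineq19_110, Ineq111_112}`, pv17's `B4Ineq111ZeroNestEta.ThmPrintedNN`; r01 g9's torus family
`B4TorusPairFam.{TorusPairInst, torusPairFam, tsupp, tsdist1, tcdist, tbdistS, tssdist, TAdm, twt, tholderQ,
tholderQ_le, extT, resT, deltaT, …}` and ITS PROVED THEOREM `B4ThmTorusPairEta.thmPrintedNN_torusPairFam` (with
`holder_far`, `siteNorm_transport_sub_le`, `decay_mono`); r04 g15's box-pair family and ITS PROVED THEOREM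
`B4ThmBoxPairEtaNoCollar.{boxPairFamNC, KmodNC, thmPrintedNN_boxPairFamNC}` over p17's `B4ThmBoxPairEta.BoxPairInst`
(`GΩ`, `DΩ`, `AΩ`, `supp`, `sdist1`, `Adm`, `wt`, `holderQ`); this seat's file 1 `B4TorusBoxReindex` (no wrap-around bond
⇒ the torus objects of a proper parallelepiped ARE the box lineage's, along p23's chart
`B2Lemma24KerOmega.{boxLabels, eB, eBquiv, eBι, shiftF}`); p23's torus geometry
`B2Prop22RegularTorusPair.{tnorm_add_le, tcdist_le_tcdist_add, tor_mem_tsupp, le_tsdist1}`;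
`B4RegionCubeCarrier.{incl, fineDom_mono}`; `B4ThmRegionPairEta.Kmod`.

WHAT IS PRINTED (p. 573 [PDF 3], verbatim).  «Theorem (Proposition 2.1 of [1]). For α < 1 there exist positive constants
δ₀, c₀, R₀ independent of A, k, Ω and depending on d, M only, c₀ on α also, such that for e sufficiently small and for an
arbitrary function f : Ω → R^N, we have (1.9) … for x, x′ ∈ Ω, and satisfying the condition dist({x,x′}, Ω^c) ≥ R₀.
Similarly (1.10) … for x ∈ Ω, dist(x, Ω^c) ≥ R₀. If Ω ⊂ Ω₀, then for δG_k(Ω,Ω₀,A) … (1.11) we have the inequalities …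
(with the same restrictions on x, x′) with the additional factor (1.12) … For some simple sets Ω, e.g. for rectangular
parallelepipeds, the inequalities hold without any restrictions on the points x, x′, i.e. for all x, x′ ∈ Ω.»  p. 572
[PDF 2]: «Another common case is to consider operators on subsets of a torus T_η which we identify with a rectangular
parallelepiped in ηZ^d with periodic conditions.»

WHY THIS FILE (the located `rect` word of YM-PLAN row N01, R325 D2, XREAD-B4 v0.5 §4).  NODE 00's `famE` of record for
the DAG leaf `b4` is r01's torus family `torusPairFam`, whose `rect` («`Ω` is a rectangular parallelepiped», the clause
under which the typed Theorem waives the restriction `dist(·, Ω^c) ≥ R₀`) reads «`Ω` is the whole torus» — weaker than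
the print, which waives the restriction for every parallelepiped.  This module inhabits the typed Theorem
`ThmPrintedNN` with `rect := True` on the family of PROPER PARALLELEPIPEDS OF THE TORUS: `Ω` = the unit blocks with
labels in a box `o + Π_ν[0, Ms_ν)` missing at least one hyperplane of blocks in every direction (`Ms_ν + 1 ≤ P_ν`),
inside `Ω₀ = T_η` (the «mixed case» of the residual named by this seat's gen 2).  What remains of the `rect` residual
after this file: parallelepipeds of `T_η` that wrap around in some direction (bands), and a parallelepiped `Ω` inside a
GENERAL `Ω₀` at points within `R₀` of `∂Ω ∩ ∂Ω₀` (lattice or torus) — an analytic statement, not claimed here.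

THE METHOD (OURS, disclosed; the print treats parallelepipeds as read).  (1.9)–(1.10) on `Ω`: by file 1 the torus
operator, Green's function and derivative of a proper parallelepiped ARE the box lineage's (`opA`, `greenA`, `derivA`
at the translated periodic field), so r04's unrestricted box Theorem transfers along the chart `eB` — values and
derivatives site by site (torus distances never exceed lattice distances of representatives), the Hölder member at
CLOSE pairs (`2(d+1)|x′−x|_T < nP_ν`: a torus-admissible contour inside `Ω` is box-admissible with the SAME weight,
since its sites are within `|Γ| ≤ (d+1)|x′−x|_T` lattice steps of `x`, where `|·|_T = |·|_∞`) and at FAR pairs by r01's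
`holder_far` (weight `≤ 2(d+1)`, two one-point derivative bounds).  (1.11)–(1.12) on `(Ω, T_η)`: at points with
`dist_T(·, Ω^c) ≥ R₀` r01's torus Theorem (restricted clause); within `R₀` of `∂Ω` the split
`δG_kf = G_k(Ω,A)f − (G_k(T_η,A)Ef)|Ω`, BOTH terms unrestricted (the box waiver on `Ω`; r01's full-torus waiver on
`T_η`, `rect` there), and the factor (1.12) is recovered from `dist_T(supp f, Ω^c) ≤ dist_T(x, supp f) + dist_T(x, Ω^c)`
(`δ₀` halved, `c₀` enlarged by `e^{δ₀(1+2R₀)}`); the `δG` Hölder member splits the same way along every admissible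
contour at pairs closer than one unit (the `T_η`-term through the inclusion `Ω ⊂ T_η`) and is bounded by the two
one-point derivative members at pairs at least one unit apart (weight `≤ 1`).

WHAT THIS MODULE PROVES (all in full).
* §0 torus∕lattice geometry: `tnorm_sub_rev`, the Lipschitz facts `tbdistS_le_tsdist1_add_tcdist`,
  `tsdist1_le_tsdist1_add`, `tcdist_le_tcdist_add'`, `supNorm_sub_le_length`, `pathRel_map`, **`le_tholderQ`** ∕
  **`le_holderQ_box`** (every admissible contour is dominated by the Hölder supremum), `exp_factor_split`.
* §1 `TorusBoxInst`, the torus pairs `toInst` (`Ω ⊂ T_η`) and `full` (`T_η ⊂ T_η`), the lattice box pair `boxI`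
  (`Ω̃ ⊂ Ω̃`, translated periodic field), the operator dictionary along the chart (`AΩ_boxI`, `GΩ_boxI`, `DΩ_boxI`,
  `GT_comp_eBι`, `DT_comp_eBι`, `fld_GT_eB`, `fld_DT_GT_eB`), the family **`torusBoxFam`** (an explicit record: every
  printed functional `rfl`-equal to `torusPairFam`'s at `toInst` — `torusBoxFam_fields` —, `rect := True`, big blocks
  of both lineages), and the hypothesis transfers `regular_toInst ∕ _full ∕ _boxI`, `bigBlocks_toInst ∕ _full ∕ _boxI`.
* §2 distances and supports along the chart and along the inclusion `Ω ⊂ T_η`: `tsdist1_le_sdist1`, `extT_inclT`,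
  `mem_tsupp_extT_iff`, `tsdist1_extT`, `supN_extT`.
* §3 contours: `supNorm_sub_le_length_T`, `tnorm_eq_supNorm_of_tAdm`, **`adm_symm_of_tAdm`** (a close admissible torus
  contour of `Ω` read on the box is admissible for the box family), `wt_symm_eq_twt`, **`term_le_holderQ_box`**,
  **`tAdm_inclT`**, `twt_inclT`, `transport_inclT`.
* §4 constants `dHalf`, `cNear`, `cAll` and the real bookkeeping (`cNear_bounds`, `cAll_bounds`, `rhs_le`, `rhs_le₂`,
  `near_bound`, `far_bound`, `far_bound₂`, `unitfar_bound`, `unitnear_bound`).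
* §5 THE SIX MEMBERS at one instance from the conclusions of the lineage Theorems at `toInst`, `full`, `boxI`:
  **`valG_Ω`**, **`valDG_Ω`**, `holder_term_Ω`, **`lhs19_Ω`**, **`dvalG_all`**, **`dvalDG_all`**, **`dlhs19_all`**.
* §6 packaging `ineq19_110_torusBoxFam`, `fam_dlhs19 ∕ fam_dvalDG ∕ fam_dvalG`, `ineq111_112_torusBoxFam`;
  **`thmPrintedNN_torusBoxFam : ThmPrintedNN (torusBoxFam F d ℓ a₋ a₊ m²₊ c β (Kmod …) (KmodNC …))`** (constants
  `δ₀ = min(δ_T,δ_B)/2`, `c₀ = cAll`, `R₀ = R_T`, `e₁ = min(e_T,e_B)`); `hypotheses_met` (non-vacuity: for every pair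
  of moduli and every threshold an admissible instance exists — the zero field, `k = 1`).
HONEST SCOPE.  As the two lineage Theorems it combines (abelian one-parameter flow (1.2), component fields, staircase
block contours, running coefficient `a_k`, windows `[a₋,a₊] × [0,m²₊]`, Euclidean site norms, `0 ≤ α < 1`, `d ≥ 1`,
`L = ℓ+1 ≥ 2`); torus read on representatives with fine period `≥ 3`; `Ω` a PROPER parallelepiped (`Ms_ν + 1 ≤ P_ν`),
`Ω₀ = T_η`; big blocks: `T_η`, `Ω` unions of `K`-blocks with `K ∣ P_ν` (r01's modulus `Kmod`) AND `K′ ∣ Ms_ν` (r04's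
modulus `KmodNC`); the Hölder constant carries r01's factor `4(d+1)`.  Definitions with bodies (`TorusBoxInst`, `toInst`,
`full`, `boxI`, `inclT`, `torusBoxFam`, `dHalf`, `cNear`, `cAll`); no `Prop`-valued fact; no `sorry`; axioms standard.
Count-neutral for YM-PLAN (typed 28∕28 · discharged 0∕28 unmoved; a later Stage-1 re-pin of `famE` is NODE 00's ∕ the
leads' decision, not made here); nothing here concerns the continuum, ℝ⁴, OS axioms, a mass gap or the Clay problem.
-/

namespace Literature.MathematicalPhysics.QuantumFieldTheory.Balaban1983to89.B4ThmTorusBox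

open Literature.MathematicalPhysics.QuantumFieldTheory.Balaban1983to89
open Literature.MathematicalPhysics.QuantumFieldTheory.Balaban1983to89.B4 (EtaSetting Ineq19_110 Ineq111_112)
open Literature.MathematicalPhysics.QuantumFieldTheory.Balaban1983to89.B4Ineq111ZeroNestEta (ThmPrintedNN)
open Literature.MathematicalPhysics.QuantumFieldTheory.Balaban1983to89.B4Reflection242 (boxDom mem_boxDom nbrs mem_nbrs
  blk supNorm_add_le supNorm_le_of_forall)
open Literature.MathematicalPhysics.QuantumFieldTheory.Balaban1983to89.B4GaugeCovariance
open Literature.MathematicalPhysics.QuantumFieldTheory.Balaban1983to89.B4ContourShift (supNorm supNorm_nonneg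
  exists_supNorm_eq abs_le_supNorm)
open Literature.MathematicalPhysics.QuantumFieldTheory.Balaban1983to89.B4TorusKernel (supNorm_neg)
open Literature.MathematicalPhysics.QuantumFieldTheory.Balaban1983to89.B4Lower18 (fineDom mem_fineDom IsBlockUnion
  fineDom_boxDom fineDom_isBlockUnion supNorm_sub_le_one_of_mem_nbrs)
open Literature.MathematicalPhysics.QuantumFieldTheory.Balaban1983to89.B4Lower18Regular (e1 PathRel transport_fieldLink
  baseEmb stairContour)
open Literature.MathematicalPhysics.QuantumFieldTheory.Balaban1983to89.B4Lower18RegularRegion (compField)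
open Literature.MathematicalPhysics.QuantumFieldTheory.Balaban1983to89.B4Lemma21Region (siteNorm)
open Literature.MathematicalPhysics.QuantumFieldTheory.Balaban1983to89.B4Lemma22ReduceZero (Box opA greenA derivA)
open Literature.MathematicalPhysics.QuantumFieldTheory.Balaban1983to89.B4Lemma22Reduce231 (supN le_supN supN_nonneg
  supN_le siteNorm_nonneg siteNorm_zero siteNorm_add_le)
open Literature.MathematicalPhysics.QuantumFieldTheory.Balaban1983to89.B4Lemma22ReduceDeriv (siteNorm_flow)
open Literature.MathematicalPhysics.QuantumFieldTheory.Balaban1983to89.B4Lemma22HolderBox (IsNNChain siteNorm_sub_le)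
open Literature.MathematicalPhysics.QuantumFieldTheory.Balaban1983to89.B4RegionCubeCarrier (incl fineDom_mono)
open Literature.MathematicalPhysics.QuantumFieldTheory.Balaban1983to89.B4ThmRegionPairEta (Kmod)
open Literature.MathematicalPhysics.QuantumFieldTheory.Balaban1983to89.B4TorusRegionOp
open Literature.MathematicalPhysics.QuantumFieldTheory.Balaban1983to89.B4TorusPairFam
open Literature.MathematicalPhysics.QuantumFieldTheory.Balaban1983to89.B4ThmTorusPairEta (thmPrintedNN_torusPairFam
  holder_far siteNorm_transport_sub_le rpow_le_of_le decay_mono)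
open Literature.MathematicalPhysics.QuantumFieldTheory.Balaban1983to89.B4ThmBoxPairEta (BoxPairInst boxPairFam)
open Literature.MathematicalPhysics.QuantumFieldTheory.Balaban1983to89.B4ThmBoxPairEtaNoCollar (boxPairFamNC KmodNC
  thmPrintedNN_boxPairFamNC)
open Literature.MathematicalPhysics.QuantumFieldTheory.Balaban1983to89.B2Lemma24SupG (κS embS ΓS)
open Literature.MathematicalPhysics.QuantumFieldTheory.Balaban1983to89.B2Lemma24KerOmega (boxLabels mem_boxLabels eB
  eBquiv eBι eBι_eq eBquiv_apply shiftF eB_surjective hnk)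
open Literature.MathematicalPhysics.QuantumFieldTheory.Balaban1983to89.B2Prop22RegularTorusPair (tnorm_add_le
  tcdist_le_tcdist_add tor_mem_tsupp le_tsdist1 le_tbdistS)
open Literature.MathematicalPhysics.QuantumFieldTheory.Balaban1983to89.B4TorusBoxReindex
open scoped Matrix

noncomputable section

variable {d : ℕ} {ι : Type} [Fintype ι] [DecidableEq ι]

/-! ## §0. Torus and lattice geometry used by the transfer -/

section Geometry

omit [Fintype ι] [DecidableEq ι] in
/-- the torus sup-norm of a difference does not depend on the order. [cite: Balaban1983RegularityDecay, p.572 «a torus T_η … with periodic conditions», dictionary] -/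
theorem tnorm_sub_rev {n : ℕ} (hn : 1 ≤ n) {P : Fin (d + 1) → ℕ} (hP : ∀ ν, 1 ≤ P ν) (a b : Fin (d + 1) → ℤ) :
    tnorm n P (a - b) = tnorm n P (b - a) := by
  have key : ∀ u v : Fin (d + 1) → ℤ, tnorm n P (u - v) ≤ tnorm n P (v - u) := by
    intro u v
    obtain ⟨t, ht⟩ := exists_lift_eq_tnorm hn hP (v - u)
    calc tnorm n P (u - v) = tnorm n P (u - v + fun ν => (per n P ν : ℤ) * (-t) ν) :=
          (tnorm_add_per n P _ (-t)).symm
      _ ≤ supNorm (u - v + fun ν => (per n P ν : ℤ) * (-t) ν) := tnorm_le_supNorm hn hP _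
      _ = supNorm (-(v - u + fun ν => (per n P ν : ℤ) * t ν)) := by
          congr 1; funext ν; simp only [Pi.add_apply, Pi.sub_apply, Pi.neg_apply]; ring
      _ = tnorm n P (v - u) := by rw [supNorm_neg, ht]
  exact le_antisymm (key a b) (key b a)

omit [DecidableEq ι] in
/-- **`dist_T(supp f, Ω^c) ≤ dist_T(x, supp f) + dist_T(x, Ω^c)`** (`dist_T(·, Ω^c)` is 1-Lipschitz; take the nearest
source point). [cite: Balaban1983RegularityDecay, (1.12) p.573 «dist(supp f, Ω^c)», dictionary] -/
theorem tbdistS_le_tsdist1_add_tcdist {n : ℕ} (hn : 1 ≤ n) (P : Fin (d + 1) → ℕ) (hP : ∀ ν, 1 ≤ P ν)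
    {ΩT : Finset (Fin (d + 1) → ℤ)} (f : ↥(fineDom n ΩT) × ι → ℝ) (x : ↥(fineDom n ΩT)) :
    tbdistS P f ≤ tsdist1 P x f + tcdist P x := by
  by_cases hne : (tsupp f).Nonempty
  · obtain ⟨z, hz, hmin⟩ := Finset.exists_mem_eq_inf' hne (fun z => tnorm n P (x.1 - z.1) / (n : ℝ))
    have hsd : tsdist1 P x f = tnorm n P (x.1 - z.1) / (n : ℝ) := by
      unfold tsdist1; rw [dif_pos hne]; exact hmin
    calc tbdistS P f ≤ tcdist P z := tbdistS_le P f hz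
      _ ≤ tcdist P x + tnorm n P (z.1 - x.1) / (n : ℝ) := tcdist_le_tcdist_add hn P hP z x
      _ = tsdist1 P x f + tcdist P x := by rw [hsd, tnorm_sub_rev hn hP z.1 x.1]; ring
  · unfold tbdistS; rw [dif_neg hne]
    exact add_nonneg (tsdist1_nonneg P x f) (tcdist_nonneg P x)

omit [DecidableEq ι] in
/-- **`dist_T(x, supp f) ≤ dist_T(x′, supp f) + |x − x′|_T`** (1-Lipschitz). [cite: Balaban1983RegularityDecay, (1.10) p.573 «dist(x, supp f)», dictionary] -/
theorem tsdist1_le_tsdist1_add {n : ℕ} (hn : 1 ≤ n) (P : Fin (d + 1) → ℕ) (hP : ∀ ν, 1 ≤ P ν)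
    {ΩT : Finset (Fin (d + 1) → ℤ)} (f : ↥(fineDom n ΩT) × ι → ℝ) (x x' : ↥(fineDom n ΩT)) :
    tsdist1 P x f ≤ tsdist1 P x' f + tnorm n P (x.1 - x'.1) / (n : ℝ) := by
  have hnr : (0 : ℝ) ≤ (n : ℝ) := Nat.cast_nonneg n
  by_cases hne : (tsupp f).Nonempty
  · obtain ⟨z, hz, hmin⟩ := Finset.exists_mem_eq_inf' hne (fun z => tnorm n P (x'.1 - z.1) / (n : ℝ))
    have hsd : tsdist1 P x' f = tnorm n P (x'.1 - z.1) / (n : ℝ) := by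
      unfold tsdist1; rw [dif_pos hne]; exact hmin
    have h1 := tsdist1_le P x f hz
    have h2 : tnorm n P (x.1 - z.1) ≤ tnorm n P (x.1 - x'.1) + tnorm n P (x'.1 - z.1) := by
      rw [← sub_add_sub_cancel x.1 x'.1 z.1]; exact tnorm_add_le hn hP _ _
    have h3 : tnorm n P (x.1 - z.1) / (n : ℝ) ≤ tnorm n P (x.1 - x'.1) / (n : ℝ) + tnorm n P (x'.1 - z.1) / (n : ℝ) := by
      rw [← add_div]; exact div_le_div_of_nonneg_right h2 hnr
    rw [hsd]; linarith
  · unfold tsdist1; rw [dif_neg hne, dif_neg hne, zero_add]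
    exact div_nonneg (tnorm_nonneg _ _ _) hnr

omit [DecidableEq ι] in
/-- `dist_T(x, Ω^c) ≤ dist_T(x′, Ω^c) + |x − x′|_T` in the order used below. [cite: Balaban1983RegularityDecay, Theorem p.573 «dist(x, Ω^c)», dictionary] -/
theorem tcdist_le_tcdist_add' {n : ℕ} (hn : 1 ≤ n) (P : Fin (d + 1) → ℕ) (hP : ∀ ν, 1 ≤ P ν)
    {ΩT : Finset (Fin (d + 1) → ℤ)} (x x' : ↥(fineDom n ΩT)) :
    tcdist P x ≤ tcdist P x' + tnorm n P (x'.1 - x.1) / (n : ℝ) := by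
  rw [tnorm_sub_rev hn hP x'.1 x.1]; exact tcdist_le_tcdist_add hn P hP x x'

omit [Fintype ι] [DecidableEq ι] in
/-- **SITES OF A NEAREST-NEIGHBOUR CHAIN STAY WITHIN ITS LENGTH OF THE START** (sup-norm).
[cite: Balaban1983RegularityDecay, p.573 «Γ_{x,x′} denotes a shortest contour», dictionary] -/
theorem supNorm_sub_le_length {R : Finset (Fin (d + 1) → ℤ)} :
    ∀ (x : ↥R) (l : List ↥R), IsNNChain x l → ∀ z ∈ l, supNorm (z.1 - x.1) ≤ l.length := by
  intro x l
  induction l generalizing x with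
  | nil => intro _ z hz; simp at hz
  | cons y l ih =>
      rintro ⟨hxy, hl⟩ z hz
      have hy : supNorm (y.1 - x.1) ≤ 1 := by
        rw [← supNorm_neg, neg_sub]; exact supNorm_sub_le_one_of_mem_nbrs hxy
      rw [List.length_cons, Nat.cast_add, Nat.cast_one]
      rcases List.mem_cons.1 hz with rfl | hz'
      · have : (0 : ℝ) ≤ l.length := Nat.cast_nonneg _
        linarith
      · have h1 := ih y hl z hz'
        have h2 : supNorm (z.1 - x.1) ≤ supNorm (z.1 - y.1) + supNorm (y.1 - x.1) := by
          rw [← sub_add_sub_cancel z.1 y.1 x.1]; exact supNorm_add_le _ _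
        linarith

omit [Fintype ι] [DecidableEq ι] in
/-- paths are preserved by maps compatible with the step relations. [cite: Balaban1983RegularityDecay, p.573 «Γ_{x,x′} … contour», dictionary] -/
theorem pathRel_map {X X' : Type} {r : X → X → Prop} {r' : X' → X' → Prop} (g : X → X')
    (hg : ∀ u v, r u v → r' (g u) (g v)) : ∀ (x : X) (l : List X), PathRel r x l → PathRel r' (g x) (l.map g) := by
  intro x l
  induction l generalizing x with
  | nil => intro _; trivial
  | cons y l ih => rintro ⟨hxy, hl⟩; exact ⟨hg _ _ hxy, ih y hl⟩

/-- **every admissible torus contour is dominated by `tholderQ`** (the supremum is over a bounded family: the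
transports are orthogonal). [cite: Balaban1983RegularityDecay, (1.9) p.573, dictionary] -/
theorem le_tholderQ {n : ℕ} (P : Fin (d + 1) → ℕ) {ΩT : Finset (Fin (d + 1) → ℤ)} (F : OrthFlow ι) (κ : ℝ)
    (Ac : (Fin (d + 1) → ℤ) → Fin (d + 1) → ℝ) {α : ℝ} {μ : Fin (d + 1)} (v : ↥(fineDom n ΩT) × ι → ℝ)
    {x x' : ↥(fineDom n ΩT)} {l : List ↥(fineDom n ΩT)} (hl : TAdm P μ x x' l) :
    twt P α x x' * siteNorm (transport (fieldLink F κ fun a b : ↥(fineDom n ΩT) => torBond n P Ac a.1 b.1) x l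
        *ᵥ fld v x' - fld v x) ≤ tholderQ P F κ Ac α μ v x x' := by
  have hw0 : 0 ≤ twt P α x x' := Real.rpow_nonneg (div_nonneg (Nat.cast_nonneg _) (tnorm_nonneg _ _ _)) _
  set B : ℝ := twt P α x x' * (siteNorm (fld v x') + siteNorm (fld v x)) with hB
  have hbdd : ∀ l' : List ↥(fineDom n ΩT),
      twt P α x x' * siteNorm (transport (fieldLink F κ fun a b : ↥(fineDom n ΩT) => torBond n P Ac a.1 b.1) x l'
        *ᵥ fld v x' - fld v x) ≤ B := fun l' =>
    mul_le_mul_of_nonneg_left (siteNorm_transport_sub_le F κ _ x l' _ _) hw0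
  have hB0 : 0 ≤ B := mul_nonneg hw0 (add_nonneg (siteNorm_nonneg _) (siteNorm_nonneg _))
  have hrange : BddAbove (Set.range fun l' : List ↥(fineDom n ΩT) => ⨆ (_ : TAdm P μ x x' l'),
      twt P α x x' * siteNorm (transport (fieldLink F κ fun a b : ↥(fineDom n ΩT) => torBond n P Ac a.1 b.1) x l'
        *ᵥ fld v x' - fld v x)) := by
    refine ⟨B, ?_⟩
    rintro _ ⟨l', rfl⟩
    exact Real.iSup_le (fun _ => hbdd l') hB0
  unfold tholderQ
  calc twt P α x x' * siteNorm (transport (fieldLink F κ fun a b : ↥(fineDom n ΩT) => torBond n P Ac a.1 b.1) x l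
          *ᵥ fld v x' - fld v x)
      = ⨆ (_ : TAdm P μ x x' l), twt P α x x' * siteNorm (transport (fieldLink F κ fun a b : ↥(fineDom n ΩT) =>
          torBond n P Ac a.1 b.1) x l *ᵥ fld v x' - fld v x) := by rw [ciSup_pos hl]
    _ ≤ _ := le_ciSup hrange l

/-- **every admissible box contour is dominated by the box family's `holderQ`**. [cite: Balaban1983RegularityDecay, (1.9) p.573, dictionary] -/
theorem le_holderQ_box {ℓ : ℕ} {amin aplus m2plus : ℝ} (i : BoxPairInst d ℓ amin aplus m2plus) (F : OrthFlow ι)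
    {α : ℝ} {μ : Fin (d + 1)} (v : ↥(Box d ℓ i.k i.Ms) × ι → ℝ) {x x' : ↥(Box d ℓ i.k i.Ms)}
    {l : List ↥(Box d ℓ i.k i.Ms)} (hl : i.Adm μ x x' l) :
    i.wt α x x' * siteNorm (transport (fieldLink F i.κ i.AΩ) x l *ᵥ fld v x' - fld v x) ≤ i.holderQ F α μ v x x' := by
  have hw0 : 0 ≤ i.wt α x x' := Real.rpow_nonneg (div_nonneg (Nat.cast_nonneg _) (supNorm_nonneg _)) _
  set B : ℝ := i.wt α x x' * (siteNorm (fld v x') + siteNorm (fld v x)) with hB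
  have hbdd : ∀ l' : List ↥(Box d ℓ i.k i.Ms),
      i.wt α x x' * siteNorm (transport (fieldLink F i.κ i.AΩ) x l' *ᵥ fld v x' - fld v x) ≤ B := fun l' =>
    mul_le_mul_of_nonneg_left (siteNorm_transport_sub_le F i.κ _ x l' _ _) hw0
  have hB0 : 0 ≤ B := mul_nonneg hw0 (add_nonneg (siteNorm_nonneg _) (siteNorm_nonneg _))
  have hrange : BddAbove (Set.range fun l' : List ↥(Box d ℓ i.k i.Ms) => ⨆ (_ : i.Adm μ x x' l'),
      i.wt α x x' * siteNorm (transport (fieldLink F i.κ i.AΩ) x l' *ᵥ fld v x' - fld v x)) := by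
    refine ⟨B, ?_⟩
    rintro _ ⟨l', rfl⟩
    exact Real.iSup_le (fun _ => hbdd l') hB0
  unfold BoxPairInst.holderQ
  calc i.wt α x x' * siteNorm (transport (fieldLink F i.κ i.AΩ) x l *ᵥ fld v x' - fld v x)
      = ⨆ (_ : i.Adm μ x x' l), i.wt α x x' * siteNorm (transport (fieldLink F i.κ i.AΩ) x l *ᵥ fld v x' - fld v x) := by
        rw [ciSup_pos hl]
    _ ≤ _ := le_ciSup hrange l

omit [Fintype ι] [DecidableEq ι] in
/-- exponential bookkeeping behind the factor (1.12) near `∂Ω`: with `bS ≤ s + t + u`, `t ≤ R`, `0 ≤ δ`,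
`e^{−2δ s} ≤ e^{δ(u + 2R)}·e^{−δ s}·e^{−(δ t' + δ bS)}` for every `t' ≤ R`. [cite: Balaban1983RegularityDecay, (1.12) p.573, dictionary] -/
theorem exp_factor_split {δ s t t' u bS R : ℝ} (hδ : 0 ≤ δ) (hbS : bS ≤ s + t + u) (ht : t ≤ R)
    (ht' : t' ≤ R) :
    Real.exp (-(2 * δ * s)) ≤ Real.exp (δ * (u + 2 * R)) * Real.exp (-(δ * s)) * Real.exp (-(δ * t' + δ * bS)) := by
  rw [← Real.exp_add, ← Real.exp_add]
  refine Real.exp_le_exp.2 ?_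
  nlinarith [mul_le_mul_of_nonneg_left hbS hδ, mul_le_mul_of_nonneg_left ht hδ, mul_le_mul_of_nonneg_left ht' hδ]

end Geometry

/-! ## §1. The instances, the family, and the operator dictionary along the chart -/

/-- AN INSTANCE: a scale `k ≥ 1` (`η = L^{-k}`), a torus `T_η = Π_ν ℤ/(nP_ν)` of `P_ν` unit blocks per direction with
fine period `nP_ν ≥ 3`, a PROPER PARALLELEPIPED `Ω ⊂ T_η` — the unit blocks with labels in the box `o + Π_ν[0, Ms_ν)`,
`Ms_ν ≥ 1`, inside the period box and missing at least one hyperplane of blocks in every direction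
(`Ms_ν + 1 ≤ P_ν`: no bond of `Ω` wraps around) — with `Ω₀ = T_η`, `(a, m²)` in the windows, a torus vector field in
component form and a coupling `e`. [cite: Balaban1983RegularityDecay, Theorem p.573 «for rectangular parallelepipeds, the inequalities hold without any restrictions on the points x, x′»; p.572 «a torus T_η … a rectangular parallelepiped … with periodic conditions»] -/
structure TorusBoxInst (d ℓ : ℕ) (amin aplus m2plus : ℝ) where
  /-- the scale -/
  k : ℕ
  hk : 1 ≤ k
  /-- the torus: `P_ν` unit blocks in direction `ν` -/
  P : Fin (d + 1) → ℕ
  hP : ∀ ν, 1 ≤ P ν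
  h3 : ∀ ν, 3 ≤ per ((ℓ + 1) ^ k) P ν
  /-- the parallelepiped `Ω`: unit sides `Ms` and label corner `o` -/
  Ms : Fin (d + 1) → ℕ
  o : Fin (d + 1) → ℤ
  hMs : ∀ ν, 1 ≤ Ms ν
  hΩP : boxLabels Ms o ⊆ boxDom P
  hwrap : ∀ ν, Ms ν + 1 ≤ P ν
  /-- the averaging weight `a` and the mass `m²` -/
  a : ℝ
  m2 : ℝ
  ha1 : amin ≤ a
  ha2 : a ≤ aplus
  hm1 : 0 ≤ m2
  hm2 : m2 ≤ m2plus
  /-- the torus component field on the period box of the fine torus -/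
  Ac : (Fin (d + 1) → ℤ) → Fin (d + 1) → ℝ
  /-- the coupling -/
  e : ℝ

namespace TorusBoxInst

variable {ℓ : ℕ} {amin aplus m2plus : ℝ} (j : TorusBoxInst d ℓ amin aplus m2plus)

/-- THE TORUS PAIR `Ω ⊂ Ω₀ = T_η` of r01's family. [cite: Balaban1983RegularityDecay, Theorem p.573 «If Ω ⊂ Ω₀ …»] -/
abbrev toInst : TorusPairInst d ℓ amin aplus m2plus where
  k := j.k
  hk := j.hk
  P := j.P
  hP := j.hP
  h3 := j.h3
  Ω₀T := boxDom j.P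
  ΩT := boxLabels j.Ms j.o
  hbox := Finset.Subset.refl _
  hsub := j.hΩP
  a := j.a
  m2 := j.m2
  ha1 := j.ha1
  ha2 := j.ha2
  hm1 := j.hm1
  hm2 := j.hm2
  Ac := j.Ac
  e := j.e

/-- THE TORUS PAIR `T_η ⊂ T_η` (the full torus, on which r01's family carries the waiver: `rect` holds).
[cite: Balaban1983RegularityDecay, p.572 «a torus T_η which we identify with a rectangular parallelepiped»] -/
abbrev full : TorusPairInst d ℓ amin aplus m2plus where
  k := j.k
  hk := j.hk
  P := j.P
  hP := j.hP
  h3 := j.h3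
  Ω₀T := boxDom j.P
  ΩT := boxDom j.P
  hbox := Finset.Subset.refl _
  hsub := Finset.Subset.refl _
  a := j.a
  m2 := j.m2
  ha1 := j.ha1
  ha2 := j.ha2
  hm1 := j.hm1
  hm2 := j.hm2
  Ac := j.Ac
  e := j.e

/-- THE LATTICE BOX PAIR `Ω̃ ⊂ Ω̃` (`Ω̃ = Π[0, nMs)`) of r04∕p17's family at the translated periodic component field
`A^per(· + n·o)` — the parallelepiped `Ω` read on representatives. [cite: Balaban1983RegularityDecay, p.572 «identify with a rectangular parallelepiped in ηZ^d», dictionary] -/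
abbrev boxI : BoxPairInst d ℓ amin aplus m2plus where
  k := j.k
  hk := j.hk
  Mb := j.Ms
  Ms := j.Ms
  o := 0
  ho := fun i => by simp
  hMs := j.hMs
  a := j.a
  m2 := j.m2
  ha1 := j.ha1
  ha2 := j.ha2
  hm1 := j.hm1
  hm2 := j.hm2
  Ac := shiftF ℓ j.k j.o (perField ((ℓ + 1) ^ j.k) j.P j.Ac)
  e := j.e

/-- the mesh `n ≥ 1`. [cite: Balaban1983RegularityDecay, p.572 «η = L^{−k}», dictionary] -/
theorem hn : 1 ≤ (ℓ + 1) ^ j.k := hnk ℓ j.k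

/-- `n > 0` as a real number. [cite: Balaban1983RegularityDecay, p.572 «η = L^{−k}», dictionary] -/
theorem n_pos : (0 : ℝ) < (((ℓ + 1) ^ j.k : ℕ) : ℝ) := by exact_mod_cast j.hn

/-- the inclusion `Ω ⊂ T_η` of carriers (r01's `incl`). [cite: Balaban1983RegularityDecay, (1.11) p.573, dictionary] -/
abbrev inclT (x : ↥(fineDom ((ℓ + 1) ^ j.k) (boxLabels j.Ms j.o))) : ↥(fineDom ((ℓ + 1) ^ j.k) (boxDom j.P)) :=
  incl j.hn j.hΩP x

omit [Fintype ι] [DecidableEq ι] in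
/-- the inclusion does not move the point (stated as a rewrite rule: the two carriers are different finite sets and
must never be compared by unfolding). [cite: Balaban1983RegularityDecay, (1.11) p.573, dictionary] -/
theorem inclT_val (x : ↥(fineDom ((ℓ + 1) ^ j.k) (boxLabels j.Ms j.o))) : (j.inclT x).1 = x.1 := by
  simp only [inclT, incl]

/-- the whole torus IS its period box of fine points: r01's `rect` holds for `full`. [cite: Balaban1983RegularityDecay, p.572 «a torus T_η which we identify with a rectangular parallelepiped»] -/
theorem rect_full : fineDom ((ℓ + 1) ^ j.k) (boxDom j.P) = boxDom (per ((ℓ + 1) ^ j.k) j.P) :=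
  fineDom_boxDom j.hn j.P

/-- the box instance's field on `Ω̃` is the translated periodic component field. [cite: Balaban1983RegularityDecay, p.572 «A_{⟨x,x+ηe_μ⟩} = A_μ(x)», dictionary] -/
theorem AΩ_boxI : j.boxI.AΩ
    = fun u v => compField (shiftF ℓ j.k j.o (perField ((ℓ + 1) ^ j.k) j.P j.Ac)) u.1 v.1 := by
  funext u v
  show compField (fun w => shiftF ℓ j.k j.o (perField ((ℓ + 1) ^ j.k) j.P j.Ac)
    (w + fun i => (((ℓ + 1) ^ j.k : ℕ) : ℤ) * ((0 : Fin (d + 1) → ℕ) i : ℤ))) u.1 v.1 = _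
  have h0 : (fun i : Fin (d + 1) => (((ℓ + 1) ^ j.k : ℕ) : ℤ) * ((0 : Fin (d + 1) → ℕ) i : ℤ)) = 0 := by
    funext i; simp
  rw [h0]
  simp only [add_zero]

/-- `G_k(Ω̃, Ã)` of the box instance, in the box lineage's letters. [cite: Balaban1983RegularityDecay, (1.6) p.572, dictionary] -/
theorem GΩ_boxI (F : OrthFlow ι) : j.boxI.GΩ F
    = greenA d F (κS ℓ j.k j.e) ℓ j.k j.a j.m2 j.Ms (embS d ℓ j.k j.Ms) (ΓS d ℓ j.k j.Ms)
        (fun u v => compField (shiftF ℓ j.k j.o (perField ((ℓ + 1) ^ j.k) j.P j.Ac)) u.1 v.1) := by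
  show greenA d F j.boxI.κ ℓ j.k j.a j.m2 j.Ms _ _ j.boxI.AΩ = _
  rw [AΩ_boxI]
  rfl

/-- `D^η_{Ã,μ}` of the box instance, in the box lineage's letters. [cite: Balaban1983RegularityDecay, (1.3) p.572, dictionary] -/
theorem DΩ_boxI (F : OrthFlow ι) (μ : Fin (d + 1)) : j.boxI.DΩ F μ
    = derivA d F (κS ℓ j.k j.e) ℓ j.k j.Ms
        (fun u v => compField (shiftF ℓ j.k j.o (perField ((ℓ + 1) ^ j.k) j.P j.Ac)) u.1 v.1) μ := by
  show derivA d F j.boxI.κ ℓ j.k j.Ms j.boxI.AΩ μ = _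
  rw [AΩ_boxI]
  rfl

variable (F : OrthFlow ι)

/-- **`G_k(Ω,A)f ∘ eB = G_k(Ω̃,Ã)(f ∘ eB)`**: the torus Green's function of the proper parallelepiped, read on the box, is
the box instance's (file 1). [cite: Balaban1983RegularityDecay, (1.6) p.572, (1.10) p.573] -/
theorem GT_comp_eBι (f : ↥(fineDom ((ℓ + 1) ^ j.k) (boxLabels j.Ms j.o)) × ι → ℝ) :
    (j.toInst.GT F *ᵥ f) ∘ ⇑(eBι (ι := ι) ℓ j.k j.Ms j.o) = j.boxI.GΩ F *ᵥ (f ∘ ⇑(eBι (ι := ι) ℓ j.k j.Ms j.o)) := by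
  rw [GΩ_boxI]
  exact inv_torusOp_mulVec_comp_eBι ℓ j.k j.Ms j.o F j.h3 j.hΩP j.hwrap j.e j.a j.m2 j.Ac f

/-- **`D_μv ∘ eB = D̃_μ(v ∘ eB)`** (file 1). [cite: Balaban1983RegularityDecay, (1.3) p.572] -/
theorem DT_comp_eBι (μ : Fin (d + 1)) (v : ↥(fineDom ((ℓ + 1) ^ j.k) (boxLabels j.Ms j.o)) × ι → ℝ) :
    (j.toInst.DT F μ *ᵥ v) ∘ ⇑(eBι (ι := ι) ℓ j.k j.Ms j.o) = j.boxI.DΩ F μ *ᵥ (v ∘ ⇑(eBι (ι := ι) ℓ j.k j.Ms j.o)) := by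
  rw [DΩ_boxI]
  exact torusDeriv_mulVec_comp_eBι ℓ j.k j.Ms j.o F j.h3 j.hΩP j.hwrap j.e j.Ac μ v

/-- `(D_μG_k(Ω,A)f) ∘ eB = D̃_μG_k(Ω̃,Ã)(f∘eB)`. [cite: Balaban1983RegularityDecay, (1.9)–(1.10) p.573] -/
theorem DTGT_comp_eBι (μ : Fin (d + 1)) (f : ↥(fineDom ((ℓ + 1) ^ j.k) (boxLabels j.Ms j.o)) × ι → ℝ) :
    (j.toInst.DT F μ *ᵥ (j.toInst.GT F *ᵥ f)) ∘ ⇑(eBι (ι := ι) ℓ j.k j.Ms j.o)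
      = j.boxI.DΩ F μ *ᵥ (j.boxI.GΩ F *ᵥ (f ∘ ⇑(eBι (ι := ι) ℓ j.k j.Ms j.o))) := by
  rw [DT_comp_eBι, GT_comp_eBι]

/-- `(G_k(Ω,A)f)(eB z) = (G_k(Ω̃,Ã)(f∘eB))(z)`. [cite: Balaban1983RegularityDecay, (1.10) p.573] -/
theorem fld_GT_eB (f : ↥(fineDom ((ℓ + 1) ^ j.k) (boxLabels j.Ms j.o)) × ι → ℝ) (z : ↥(Box d ℓ j.k j.Ms)) :
    fld (j.toInst.GT F *ᵥ f) (eB ℓ j.k j.Ms j.o z) = fld (j.boxI.GΩ F *ᵥ (f ∘ ⇑(eBι (ι := ι) ℓ j.k j.Ms j.o))) z := by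
  rw [← GT_comp_eBι]; rfl

/-- `(D_μG_k(Ω,A)f)(eB z) = (D̃_μG_k(Ω̃,Ã)(f∘eB))(z)`. [cite: Balaban1983RegularityDecay, (1.9)–(1.10) p.573] -/
theorem fld_DT_GT_eB (μ : Fin (d + 1)) (f : ↥(fineDom ((ℓ + 1) ^ j.k) (boxLabels j.Ms j.o)) × ι → ℝ)
    (z : ↥(Box d ℓ j.k j.Ms)) :
    fld (j.toInst.DT F μ *ᵥ (j.toInst.GT F *ᵥ f)) (eB ℓ j.k j.Ms j.o z)
      = fld (j.boxI.DΩ F μ *ᵥ (j.boxI.GΩ F *ᵥ (f ∘ ⇑(eBι (ι := ι) ℓ j.k j.Ms j.o)))) z := by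
  rw [← DTGT_comp_eBι]; rfl

end TorusBoxInst

open TorusBoxInst

/-- **THE FAMILY OF SETTINGS OF THE THEOREM ON PROPER PARALLELEPIPEDS OF THE TORUS** (`Ω ⊂ Ω₀ = T_η`): b04's
`EtaSetting` filled with THE SAME printed objects as r01's `torusPairFam` at the torus pair `toInst` (torus sup-metric
distances, torus contours and Hölder quotient, (1.7) with torus differences on `Ω₀ = T_η`, the operators (1.3)/(1.6) of
`Ω` and the `δG_k` of the pair — field by field `rfl`, see `torusBoxFam_fields`), with TWO changes: `rect := True`
(«for rectangular parallelepipeds, the inequalities hold without any restrictions on the points x, x′») and the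
big-block condition of BOTH lineages (`T_η` and `Ω` unions of `K`-blocks, `K ∣ P_ν` — r01; the sides of `Ω` multiples
of `K′` — r04∕p17).  Parameters: the flow, `d`, `ℓ` (`L = ℓ+1`), the windows, the (1.7) constants `(c, β)`, the two
moduli. [cite: Balaban1983RegularityDecay, (1.7) p.572, Theorem (1.9)–(1.12) p.573 with its last sentence; p.572 «operators on subsets of a torus T_η»] -/
def torusBoxFam (F : OrthFlow ι) (d ℓ : ℕ) (amin aplus m2plus creg β : ℝ) (K K' : ℕ)
    (j : TorusBoxInst d ℓ amin aplus m2plus) : EtaSetting where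
  Site := ↥(fineDom ((ℓ + 1) ^ j.k) (boxLabels j.Ms j.o))
  Dir := Fin (d + 1)
  Src := ↥(fineDom ((ℓ + 1) ^ j.k) (boxLabels j.Ms j.o)) × ι → ℝ
  e := j.e
  regular := ∀ x ∈ fineDom ((ℓ + 1) ^ j.k) (boxDom j.P), ∀ μ ν : Fin (d + 1),
    |j.Ac (twrap ((ℓ + 1) ^ j.k) j.P (x + e1 μ)) ν - j.Ac x ν| ≤ creg * j.e ^ (β - 1) / ((ℓ + 1) ^ j.k : ℕ)
  bigBlocks := (IsBlockUnion K (boxDom j.P) ∧ IsBlockUnion K (boxLabels j.Ms j.o) ∧ ∀ ν, K ∣ j.P ν) ∧ ∀ ν, K' ∣ j.Ms ν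
  rect := True
  pdist := fun x y => tnorm ((ℓ + 1) ^ j.k) j.P (x.1 - y.1) / (((ℓ + 1) ^ j.k : ℕ) : ℝ)
  sdist1 := fun x f => tsdist1 j.P x f
  sdist2 := fun x x' f => min (tsdist1 j.P x f) (tsdist1 j.P x' f)
  bdist1 := fun x => tcdist j.P x
  bdist2 := fun x x' => min (tcdist j.P x) (tcdist j.P x')
  bdistS := fun f => tbdistS j.P f
  supNorm := fun f => supN f
  l2Norm := fun f => Real.sqrt (∑ p, f p ^ 2)
  ssdist := fun f f' => tssdist j.P f f'
  lhs19 := fun α μ f x x' => tholderQ j.P F j.toInst.κ j.Ac α μ (j.toInst.DT F μ *ᵥ (j.toInst.GT F *ᵥ f)) x x'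
  valDG := fun μ f x => siteNorm (fld (j.toInst.DT F μ *ᵥ (j.toInst.GT F *ᵥ f)) x)
  valG := fun f x => siteNorm (fld (j.toInst.GT F *ᵥ f) x)
  dlhs19 := fun α μ f x x' => tholderQ j.P F j.toInst.κ j.Ac α μ (j.toInst.DT F μ *ᵥ j.toInst.deltaT F f) x x'
  dvalDG := fun μ f x => siteNorm (fld (j.toInst.DT F μ *ᵥ j.toInst.deltaT F f) x)
  dvalG := fun f x => siteNorm (fld (j.toInst.deltaT F f) x)
  lower18 := fun γ => ∀ v : ↥(fineDom ((ℓ + 1) ^ j.k) (boxLabels j.Ms j.o)) × ι → ℝ,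
    γ * (v ⬝ᵥ v) ≤ v ⬝ᵥ (j.toInst.HT F *ᵥ v)
  pair := fun m μ ν f' f => |f' ⬝ᵥ j.toInst.opXT F m μ ν f|
  dpair := fun m μ ν f' f => |f' ⬝ᵥ (j.toInst.opXT F m μ ν f - j.toInst.resT (j.toInst.opX₀T F m μ ν (j.toInst.extT f)))|

/-- **THE NEW FAMILY IS r01's `torusPairFam` AT `toInst` EXCEPT FOR `rect` AND `bigBlocks`**: every printed functional,
the carrier types, the coupling and the (1.7) clause agree definitionally.
[cite: Balaban1983RegularityDecay, Theorem (1.9)–(1.12) p.573, dictionary] -/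
theorem torusBoxFam_fields (F : OrthFlow ι) (d ℓ : ℕ) (amin aplus m2plus creg β : ℝ) (K K' : ℕ)
    (j : TorusBoxInst d ℓ amin aplus m2plus) :
    (torusBoxFam F d ℓ amin aplus m2plus creg β K K' j).regular
        = (torusPairFam F d ℓ amin aplus m2plus creg β K j.toInst).regular ∧
      ((torusBoxFam F d ℓ amin aplus m2plus creg β K K' j).bigBlocks
        ↔ (torusPairFam F d ℓ amin aplus m2plus creg β K j.toInst).bigBlocks ∧ ∀ ν, K' ∣ j.Ms ν) ∧
      (torusBoxFam F d ℓ amin aplus m2plus creg β K K' j).lhs19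
        = (torusPairFam F d ℓ amin aplus m2plus creg β K j.toInst).lhs19 ∧
      (torusBoxFam F d ℓ amin aplus m2plus creg β K K' j).valDG
        = (torusPairFam F d ℓ amin aplus m2plus creg β K j.toInst).valDG ∧
      (torusBoxFam F d ℓ amin aplus m2plus creg β K K' j).valG
        = (torusPairFam F d ℓ amin aplus m2plus creg β K j.toInst).valG ∧
      (torusBoxFam F d ℓ amin aplus m2plus creg β K K' j).dlhs19
        = (torusPairFam F d ℓ amin aplus m2plus creg β K j.toInst).dlhs19 ∧
      (torusBoxFam F d ℓ amin aplus m2plus creg β K K' j).dvalDG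
        = (torusPairFam F d ℓ amin aplus m2plus creg β K j.toInst).dvalDG ∧
      (torusBoxFam F d ℓ amin aplus m2plus creg β K K' j).dvalG
        = (torusPairFam F d ℓ amin aplus m2plus creg β K j.toInst).dvalG ∧
      (torusBoxFam F d ℓ amin aplus m2plus creg β K K' j).sdist2
        = (torusPairFam F d ℓ amin aplus m2plus creg β K j.toInst).sdist2 ∧
      (torusBoxFam F d ℓ amin aplus m2plus creg β K K' j).bdist2
        = (torusPairFam F d ℓ amin aplus m2plus creg β K j.toInst).bdist2 ∧
      (torusBoxFam F d ℓ amin aplus m2plus creg β K K' j).bdistS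
        = (torusPairFam F d ℓ amin aplus m2plus creg β K j.toInst).bdistS ∧
      (torusBoxFam F d ℓ amin aplus m2plus creg β K K' j).supNorm
        = (torusPairFam F d ℓ amin aplus m2plus creg β K j.toInst).supNorm ∧
      (torusBoxFam F d ℓ amin aplus m2plus creg β K K' j).pair
        = (torusPairFam F d ℓ amin aplus m2plus creg β K j.toInst).pair ∧
      (torusBoxFam F d ℓ amin aplus m2plus creg β K K' j).dpair
        = (torusPairFam F d ℓ amin aplus m2plus creg β K j.toInst).dpair :=
  ⟨rfl, Iff.rfl, rfl, rfl, rfl, rfl, rfl, rfl, rfl, rfl, rfl, rfl, rfl, rfl⟩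

namespace TorusBoxInst

section Dictionary

variable {ℓ : ℕ} {amin aplus m2plus : ℝ} (j : TorusBoxInst d ℓ amin aplus m2plus) (F : OrthFlow ι)
  {creg β : ℝ} {K K' : ℕ}

/-- the regularity clause of the new family is r01's at `toInst` (definitionally). [cite: Balaban1983RegularityDecay, (1.7) p.572] -/
theorem regular_toInst (h : (torusBoxFam F d ℓ amin aplus m2plus creg β K K' j).regular) :
    (torusPairFam F d ℓ amin aplus m2plus creg β K j.toInst).regular := h

/-- (1.7) on `Ω₀ = T_η` is the same clause for the full-torus pair. [cite: Balaban1983RegularityDecay, (1.7) p.572] -/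
theorem regular_full (h : (torusBoxFam F d ℓ amin aplus m2plus creg β K K' j).regular) :
    (torusPairFam F d ℓ amin aplus m2plus creg β K j.full).regular := h

/-- **(1.7) TRANSFERS TO THE BOX INSTANCE**: the translated periodic field is (1.7)-regular on `Ω̃ = Π[0,nMs)` with the
lattice forward differences (every bond of `Ω̃ + n·o` is a torus bond of `T_η`). [cite: Balaban1983RegularityDecay, (1.7) p.572] -/
theorem regular_boxI (h : (torusBoxFam F d ℓ amin aplus m2plus creg β K K' j).regular) :
    (boxPairFamNC F d ℓ amin aplus m2plus creg β K' j.boxI).regular := by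
  dsimp only [torusBoxFam] at h
  dsimp only [boxPairFamNC, boxPairFam]
  intro x hx μ ν
  have hx' : (x + fun i => (((ℓ + 1) ^ j.k : ℕ) : ℤ) * j.o i) ∈ fineDom ((ℓ + 1) ^ j.k) (boxLabels j.Ms j.o) :=
    (add_mem_fineDom_iff ℓ j.k j.Ms j.o x).2 hx
  have hxP : (x + fun i => (((ℓ + 1) ^ j.k : ℕ) : ℤ) * j.o i) ∈ boxDom (per ((ℓ + 1) ^ j.k) j.P) :=
    val_mem_perBox j.hn j.hΩP ⟨_, hx'⟩
  have hx0 : (x + fun i => (((ℓ + 1) ^ j.k : ℕ) : ℤ) * j.o i) ∈ fineDom ((ℓ + 1) ^ j.k) (boxDom j.P) := by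
    rw [j.rect_full]; exact hxP
  have h' := h _ hx0 μ ν
  simp only [shiftF, perField]
  rw [twrap_eq_self hxP, add_right_comm x (e1 μ)]
  exact h'

/-- the big-block clause restricted to r01's family at `toInst`. [cite: Balaban1983RegularityDecay, p.572 «unions of big blocks»] -/
theorem bigBlocks_toInst (h : (torusBoxFam F d ℓ amin aplus m2plus creg β K K' j).bigBlocks) :
    (torusPairFam F d ℓ amin aplus m2plus creg β K j.toInst).bigBlocks := h.1

/-- the big-block clause for the full-torus pair. [cite: Balaban1983RegularityDecay, p.572 «unions of big blocks»] -/
theorem bigBlocks_full (h : (torusBoxFam F d ℓ amin aplus m2plus creg β K K' j).bigBlocks) :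
    (torusPairFam F d ℓ amin aplus m2plus creg β K j.full).bigBlocks := by
  obtain ⟨⟨h0, -, hP⟩, -⟩ := h
  exact ⟨h0, h0, hP⟩

/-- the big-block clause for the box instance (`K′ ∣ Ms_ν`). [cite: Balaban1983RegularityDecay, p.572 «unions of big blocks»] -/
theorem bigBlocks_boxI (h : (torusBoxFam F d ℓ amin aplus m2plus creg β K K' j).bigBlocks) :
    (boxPairFamNC F d ℓ amin aplus m2plus creg β K' j.boxI).bigBlocks := ⟨h.2, h.2⟩

end Dictionary

/-! ## §2. Supports and distances along the chart and along the inclusion `Ω ⊂ T_η` -/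

section Distances

variable {ℓ : ℕ} {amin aplus m2plus : ℝ} (j : TorusBoxInst d ℓ amin aplus m2plus)

omit [DecidableEq ι] in
/-- membership in the box instance's support. [cite: Balaban1983RegularityDecay, (1.9) p.573 «supp f», dictionary] -/
theorem mem_supp_boxI {g : ↥(Box d ℓ j.k j.Ms) × ι → ℝ} {z : ↥(Box d ℓ j.k j.Ms)} :
    z ∈ j.boxI.supp g ↔ ∃ c, g (z, c) ≠ 0 := by
  unfold BoxPairInst.supp
  simp

omit [DecidableEq ι] in
/-- the support read on the box is the chart preimage of the support. [cite: Balaban1983RegularityDecay, (1.9) p.573 «supp f», dictionary] -/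
theorem mem_supp_comp_iff (f : ↥(fineDom ((ℓ + 1) ^ j.k) (boxLabels j.Ms j.o)) × ι → ℝ) (z : ↥(Box d ℓ j.k j.Ms)) :
    z ∈ j.boxI.supp (f ∘ ⇑(eBι (ι := ι) ℓ j.k j.Ms j.o)) ↔ eB ℓ j.k j.Ms j.o z ∈ tsupp f := by
  rw [mem_supp_boxI, tor_mem_tsupp]
  rfl

omit [DecidableEq ι] in
/-- **TORUS DISTANCES TO THE SUPPORT NEVER EXCEED THE BOX ONES**: `dist_T(eB z, supp f) ≤ dist(z, supp(f∘eB))`.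
[cite: Balaban1983RegularityDecay, (1.10) p.573 «dist(x, supp f)», p.572 «periodic conditions», dictionary] -/
theorem tsdist1_le_sdist1 (f : ↥(fineDom ((ℓ + 1) ^ j.k) (boxLabels j.Ms j.o)) × ι → ℝ) (z : ↥(Box d ℓ j.k j.Ms)) :
    tsdist1 j.P (eB ℓ j.k j.Ms j.o z) f ≤ j.boxI.sdist1 z (f ∘ ⇑(eBι (ι := ι) ℓ j.k j.Ms j.o)) := by
  by_cases hne : (j.boxI.supp (f ∘ ⇑(eBι (ι := ι) ℓ j.k j.Ms j.o))).Nonempty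
  · unfold BoxPairInst.sdist1
    rw [dif_pos hne]
    refine Finset.le_inf' _ _ fun z' hz' => ?_
    have hz'T : eB ℓ j.k j.Ms j.o z' ∈ tsupp f := (j.mem_supp_comp_iff f z').1 hz'
    refine (tsdist1_le j.P _ f hz'T).trans ?_
    rw [eB_sub]
    exact div_le_div_of_nonneg_right (tnorm_le_supNorm j.hn j.hP _) j.n_pos.le
  · unfold BoxPairInst.sdist1
    rw [dif_neg hne]
    have hne' : ¬ (tsupp f).Nonempty := by
      rintro ⟨w, hw⟩
      obtain ⟨z', rfl⟩ := eB_surjective ℓ j.k j.Ms j.o w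
      exact hne ⟨z', (j.mem_supp_comp_iff f z').2 hw⟩
    unfold tsdist1
    rw [dif_neg hne']

omit [Fintype ι] [DecidableEq ι] in
/-- the extension by zero at a site of `Ω`. [cite: Balaban1983RegularityDecay, (1.11) p.573, dictionary] -/
theorem extT_inclT (f : ↥(fineDom ((ℓ + 1) ^ j.k) (boxLabels j.Ms j.o)) × ι → ℝ)
    (x : ↥(fineDom ((ℓ + 1) ^ j.k) (boxLabels j.Ms j.o))) (c : ι) : j.toInst.extT f (j.inclT x, c) = f (x, c) := by
  have hx : blk ((ℓ + 1) ^ j.k) (j.inclT x).1 ∈ boxLabels j.Ms j.o := by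
    rw [inclT_val]; exact (mem_fineDom j.hn).1 x.2
  refine (j.toInst.extT_of_mem f (j.inclT x, c) hx).trans ?_
  exact congrArg (fun y : ↥(fineDom ((ℓ + 1) ^ j.k) (boxLabels j.Ms j.o)) => f (y, c))
    (Subtype.ext (j.inclT_val x))

omit [Fintype ι] [DecidableEq ι] in
/-- the extension by zero off `Ω`. [cite: Balaban1983RegularityDecay, (1.11) p.573, dictionary] -/
theorem extT_of_not_mem' (f : ↥(fineDom ((ℓ + 1) ^ j.k) (boxLabels j.Ms j.o)) × ι → ℝ)
    (w : ↥(fineDom ((ℓ + 1) ^ j.k) (boxDom j.P))) (hw : blk ((ℓ + 1) ^ j.k) w.1 ∉ boxLabels j.Ms j.o) (c : ι) :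
    j.toInst.extT f (w, c) = 0 :=
  j.toInst.extT_of_not_mem f (w, c) hw

omit [Fintype ι] [DecidableEq ι] in
/-- a point of `T_η` whose block label lies in the label box is the inclusion of a point of `Ω`.
[cite: Balaban1983RegularityDecay, (1.1) p.572, dictionary] -/
theorem exists_inclT_of_blk_mem (w : ↥(fineDom ((ℓ + 1) ^ j.k) (boxDom j.P)))
    (hw : blk ((ℓ + 1) ^ j.k) w.1 ∈ boxLabels j.Ms j.o) : ∃ x, j.inclT x = w :=
  ⟨⟨w.1, (mem_fineDom j.hn).2 hw⟩, Subtype.ext (j.inclT_val _)⟩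

omit [DecidableEq ι] in
/-- the support of the extension is the image of the support. [cite: Balaban1983RegularityDecay, (1.11) p.573, dictionary] -/
theorem mem_tsupp_extT_iff (f : ↥(fineDom ((ℓ + 1) ^ j.k) (boxLabels j.Ms j.o)) × ι → ℝ)
    (w : ↥(fineDom ((ℓ + 1) ^ j.k) (boxDom j.P))) :
    w ∈ tsupp (j.toInst.extT f) ↔ ∃ x ∈ tsupp f, j.inclT x = w := by
  rw [tor_mem_tsupp]
  constructor
  · rintro ⟨c, hc⟩
    by_cases hw : blk ((ℓ + 1) ^ j.k) w.1 ∈ boxLabels j.Ms j.o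
    · obtain ⟨x, rfl⟩ := j.exists_inclT_of_blk_mem w hw
      refine ⟨x, ?_, rfl⟩
      rw [tor_mem_tsupp]
      exact ⟨c, by rwa [j.extT_inclT] at hc⟩
    · exact absurd (j.extT_of_not_mem' f w hw c) hc
  · rintro ⟨x, hx, rfl⟩
    obtain ⟨c, hc⟩ := (tor_mem_tsupp).1 hx
    exact ⟨c, by rwa [j.extT_inclT]⟩

omit [DecidableEq ι] in
/-- **`dist_T(x, supp Ef) = dist_T(x, supp f)`** for the extension by zero from `Ω` to `T_η` (same torus metric).
[cite: Balaban1983RegularityDecay, (1.10)–(1.11) p.573, dictionary] -/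
theorem tsdist1_extT (f : ↥(fineDom ((ℓ + 1) ^ j.k) (boxLabels j.Ms j.o)) × ι → ℝ)
    (x : ↥(fineDom ((ℓ + 1) ^ j.k) (boxLabels j.Ms j.o))) :
    tsdist1 j.P (j.inclT x) (j.toInst.extT f) = tsdist1 j.P x f := by
  by_cases hne : (tsupp f).Nonempty
  · have hne' : (tsupp (j.toInst.extT f)).Nonempty := by
      obtain ⟨z, hz⟩ := hne
      exact ⟨j.inclT z, (j.mem_tsupp_extT_iff f _).2 ⟨z, hz, rfl⟩⟩
    refine le_antisymm ?_ ?_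
    · refine le_tsdist1 j.P x f hne fun z hz => ?_
      have hmem : j.inclT z ∈ tsupp (j.toInst.extT f) := (j.mem_tsupp_extT_iff f (j.inclT z)).2 ⟨z, hz, rfl⟩
      have h := tsdist1_le j.P (j.inclT x) (j.toInst.extT f) hmem
      rw [inclT_val, inclT_val] at h
      exact h
    · refine le_tsdist1 j.P (j.inclT x) (j.toInst.extT f) hne' fun w hw => ?_
      obtain ⟨z, hz, rfl⟩ := (j.mem_tsupp_extT_iff f w).1 hw
      rw [inclT_val, inclT_val]
      exact tsdist1_le j.P x f hz
  · have hne' : ¬ (tsupp (j.toInst.extT f)).Nonempty := by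
      rintro ⟨w, hw⟩
      obtain ⟨z, hz, -⟩ := (j.mem_tsupp_extT_iff f w).1 hw
      exact hne ⟨z, hz⟩
    unfold tsdist1
    rw [dif_neg hne, dif_neg hne']

omit [Fintype ι] [DecidableEq ι] in
/-- the extension at a site of `Ω`, as a colour vector. [cite: Balaban1983RegularityDecay, (1.11) p.573, dictionary] -/
theorem fld_extT_inclT (f : ↥(fineDom ((ℓ + 1) ^ j.k) (boxLabels j.Ms j.o)) × ι → ℝ)
    (x : ↥(fineDom ((ℓ + 1) ^ j.k) (boxLabels j.Ms j.o))) : fld (j.toInst.extT f) (j.inclT x) = fld f x := by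
  funext c; exact j.extT_inclT f x c

omit [DecidableEq ι] in
/-- **`‖Ef‖_∞ = ‖f‖_∞`** for the extension by zero. [cite: Balaban1983RegularityDecay, (1.11) p.573, dictionary] -/
theorem supN_extT (f : ↥(fineDom ((ℓ + 1) ^ j.k) (boxLabels j.Ms j.o)) × ι → ℝ) :
    supN (j.toInst.extT f) = supN f := by
  refine le_antisymm (supN_le (supN_nonneg f) fun w => ?_) (supN_le (supN_nonneg _) fun x => ?_)
  · by_cases hw : blk ((ℓ + 1) ^ j.k) w.1 ∈ boxLabels j.Ms j.o
    · obtain ⟨x, rfl⟩ := j.exists_inclT_of_blk_mem w hw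
      rw [fld_extT_inclT]; exact le_supN f _
    · have : fld (j.toInst.extT f) w = 0 := by
        funext c; exact j.extT_of_not_mem' f w hw c
      rw [this, siteNorm_zero]; exact supN_nonneg f
  · rw [← fld_extT_inclT]; exact le_supN _ _

end Distances

/-! ## §3. Contours: close pairs read on the box, the inclusion `Ω ⊂ T_η` -/

section Contours

variable {ℓ : ℕ} {amin aplus m2plus : ℝ} (j : TorusBoxInst d ℓ amin aplus m2plus) (F : OrthFlow ι)

omit [Fintype ι] [DecidableEq ι] in
/-- differences of back-translates are differences. [cite: Balaban1983RegularityDecay, (1.9) p.573 «|x − x′|», dictionary] -/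
theorem symm_sub (x z : ↥(fineDom ((ℓ + 1) ^ j.k) (boxLabels j.Ms j.o))) :
    ((eBquiv ℓ j.k j.Ms j.o).symm z).1 - ((eBquiv ℓ j.k j.Ms j.o).symm x).1 = z.1 - x.1 := by
  conv_rhs => rw [val_eq_symm_add ℓ j.k j.Ms j.o z, val_eq_symm_add ℓ j.k j.Ms j.o x]
  rw [add_sub_add_right_eq_sub]

omit [Fintype ι] [DecidableEq ι] in
/-- **SITES OF A TORUS CHAIN OF `Ω` STAY WITHIN ITS LENGTH OF THE START, IN THE LATTICE SUP-NORM OF REPRESENTATIVES**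
(no bond of the proper parallelepiped wraps around). [cite: Balaban1983RegularityDecay, p.573 «Γ_{x,x′} … contour», p.572 «periodic conditions», dictionary] -/
theorem supNorm_sub_le_length_T {x : ↥(fineDom ((ℓ + 1) ^ j.k) (boxLabels j.Ms j.o))}
    {l : List ↥(fineDom ((ℓ + 1) ^ j.k) (boxLabels j.Ms j.o))}
    (hpath : PathRel (fun u v : ↥(fineDom ((ℓ + 1) ^ j.k) (boxLabels j.Ms j.o)) =>
      TNbr ((ℓ + 1) ^ j.k) j.P u.1 v.1) x l) :
    ∀ z ∈ l, supNorm (z.1 - x.1) ≤ l.length := by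
  intro z hz
  have hch := isNNChain_map_symm ℓ j.k j.Ms j.o j.hΩP j.hwrap x l hpath
  have hz' : (eBquiv ℓ j.k j.Ms j.o).symm z ∈ l.map (eBquiv ℓ j.k j.Ms j.o).symm := List.mem_map.2 ⟨z, hz, rfl⟩
  have h := supNorm_sub_le_length _ _ hch _ hz'
  rw [List.length_map, j.symm_sub] at h
  exact h

omit [Fintype ι] [DecidableEq ι] in
/-- **AT A CLOSE PAIR THE TORUS DISTANCES ALONG AN ADMISSIBLE CONTOUR ARE LATTICE DISTANCES**: if
`2(d+1)|x′−x|_T < nP_ν` for all `ν`, every site `z` of an admissible torus contour from `x` to `x′` inside the proper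
parallelepiped has `|z − x|_T = |z − x|_∞`, and `|x′ − x|_T = |x′ − x|_∞`. [cite: Balaban1983RegularityDecay, p.573 «Γ_{x,x′} denotes a shortest contour», p.572 «periodic conditions», dictionary] -/
theorem tnorm_eq_supNorm_of_tAdm {μ : Fin (d + 1)} {x x' : ↥(fineDom ((ℓ + 1) ^ j.k) (boxLabels j.Ms j.o))}
    {l : List ↥(fineDom ((ℓ + 1) ^ j.k) (boxLabels j.Ms j.o))} (hl : TAdm j.P μ x x' l)
    (hclose : ∀ ν, 2 * (((d : ℝ) + 1) * tnorm ((ℓ + 1) ^ j.k) j.P (x'.1 - x.1)) < per ((ℓ + 1) ^ j.k) j.P ν) :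
    (∀ z ∈ l, tnorm ((ℓ + 1) ^ j.k) j.P (z.1 - x.1) = supNorm (z.1 - x.1)) ∧
      tnorm ((ℓ + 1) ^ j.k) j.P (x'.1 - x.1) = supNorm (x'.1 - x.1) := by
  obtain ⟨-, -, hne, hpath, hend, hlen, -⟩ := hl
  have hsmall : ∀ v : Fin (d + 1) → ℤ, supNorm v ≤ (l.length : ℝ) →
      ∀ ν, 2 * |v ν| < per ((ℓ + 1) ^ j.k) j.P ν := by
    intro v hv ν
    have h1 : ((|v ν| : ℤ) : ℝ) ≤ supNorm v := abs_le_supNorm v ν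
    have h2 := hclose ν
    have h3 : (2 : ℝ) * ((|v ν| : ℤ) : ℝ) < per ((ℓ + 1) ^ j.k) j.P ν := by linarith
    exact_mod_cast h3
  have hz : ∀ z ∈ l, tnorm ((ℓ + 1) ^ j.k) j.P (z.1 - x.1) = supNorm (z.1 - x.1) := fun z hz =>
    tnorm_eq_supNorm_of_small (hsmall _ (j.supNorm_sub_le_length_T hpath z hz))
  refine ⟨hz, ?_⟩
  rcases pathEnd_eq_or_mem x l with h | h
  · exact absurd (congrArg Subtype.val (hend.symm.trans h)) hne
  · rw [hend] at h; exact hz x' h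

omit [Fintype ι] [DecidableEq ι] in
/-- **A CLOSE ADMISSIBLE TORUS CONTOUR OF `Ω`, READ ON THE BOX, IS AN ADMISSIBLE BOX CONTOUR** of r04∕p17's family (same
end bonds, same length, same ball; weights agree). [cite: Balaban1983RegularityDecay, p.573 «Γ_{x,x′} denotes a shortest contour», (1.9) p.573] -/
theorem adm_symm_of_tAdm {μ : Fin (d + 1)} {x x' : ↥(fineDom ((ℓ + 1) ^ j.k) (boxLabels j.Ms j.o))}
    {l : List ↥(fineDom ((ℓ + 1) ^ j.k) (boxLabels j.Ms j.o))} (hl : TAdm j.P μ x x' l)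
    (hclose : ∀ ν, 2 * (((d : ℝ) + 1) * tnorm ((ℓ + 1) ^ j.k) j.P (x'.1 - x.1)) < per ((ℓ + 1) ^ j.k) j.P ν) :
    j.boxI.Adm μ ((eBquiv ℓ j.k j.Ms j.o).symm x) ((eBquiv ℓ j.k j.Ms j.o).symm x')
      (l.map (eBquiv ℓ j.k j.Ms j.o).symm) := by
  obtain ⟨hzT, hT⟩ := j.tnorm_eq_supNorm_of_tAdm hl hclose
  obtain ⟨hbx, hbx', hne, hpath, hend, hlen, hball⟩ := hl
  have hbond : ∀ {y : ↥(fineDom ((ℓ + 1) ^ j.k) (boxLabels j.Ms j.o))},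
      twrap ((ℓ + 1) ^ j.k) j.P (y.1 + e1 μ) ∈ fineDom ((ℓ + 1) ^ j.k) (boxLabels j.Ms j.o) →
      ((eBquiv ℓ j.k j.Ms j.o).symm y).1 + e1 μ ∈ Box d ℓ j.k j.Ms := by
    intro y hy
    have h1 := (twrap_add_e1_mem_iff j.hn j.hΩP j.hwrap y.2 μ).1 hy
    rw [val_eq_symm_add ℓ j.k j.Ms j.o y, add_right_comm] at h1
    exact (add_mem_fineDom_iff ℓ j.k j.Ms j.o _).1 h1
  refine ⟨hbond hbx, hbond hbx', ?_, isNNChain_map_symm ℓ j.k j.Ms j.o j.hΩP j.hwrap x l hpath, ?_, ?_, ?_⟩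
  · intro h
    apply hne
    rw [val_eq_symm_add ℓ j.k j.Ms j.o x', val_eq_symm_add ℓ j.k j.Ms j.o x, h]
  · rw [pathEnd_map, hend]
  · show ((l.map (eBquiv ℓ j.k j.Ms j.o).symm).length : ℝ) ≤ ((d : ℝ) + 1) * supNorm (_ - _)
    rw [List.length_map, j.symm_sub, ← hT]
    exact hlen
  · intro z' hz'
    obtain ⟨z, hz, rfl⟩ := List.mem_map.1 hz'
    show supNorm (_ - _) ≤ supNorm (_ - _)
    rw [j.symm_sub, j.symm_sub, ← hT, ← hzT z hz]
    exact hball z hz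

omit [Fintype ι] [DecidableEq ι] in
/-- the weights agree at a close pair. [cite: Balaban1983RegularityDecay, (1.9) p.573 «|x − x′|^{−α}», dictionary] -/
theorem wt_symm_eq_twt {μ : Fin (d + 1)} {x x' : ↥(fineDom ((ℓ + 1) ^ j.k) (boxLabels j.Ms j.o))}
    {l : List ↥(fineDom ((ℓ + 1) ^ j.k) (boxLabels j.Ms j.o))} (hl : TAdm j.P μ x x' l)
    (hclose : ∀ ν, 2 * (((d : ℝ) + 1) * tnorm ((ℓ + 1) ^ j.k) j.P (x'.1 - x.1)) < per ((ℓ + 1) ^ j.k) j.P ν)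
    (α : ℝ) :
    j.boxI.wt α ((eBquiv ℓ j.k j.Ms j.o).symm x) ((eBquiv ℓ j.k j.Ms j.o).symm x') = twt j.P α x x' := by
  obtain ⟨-, hT⟩ := j.tnorm_eq_supNorm_of_tAdm hl hclose
  show (_ / supNorm (_ - _)) ^ α = (_ / _) ^ α
  rw [j.symm_sub, ← hT]

omit [Fintype ι] [DecidableEq ι] in
/-- values of a field read on the box at a back-translate. [cite: Balaban1983RegularityDecay, (1.9) p.573, dictionary] -/
theorem fld_comp_symm (v : ↥(fineDom ((ℓ + 1) ^ j.k) (boxLabels j.Ms j.o)) × ι → ℝ)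
    (y : ↥(fineDom ((ℓ + 1) ^ j.k) (boxLabels j.Ms j.o))) :
    fld (v ∘ ⇑(eBι (ι := ι) ℓ j.k j.Ms j.o)) ((eBquiv ℓ j.k j.Ms j.o).symm y) = fld v y := by
  rw [fld_comp_eBι, ← eBquiv_apply, Equiv.apply_symm_apply]

/-- **THE HÖLDER TERM OF A CLOSE ADMISSIBLE TORUS CONTOUR IS DOMINATED BY THE BOX FAMILY's `holderQ`** (same weight, same
transporter — file 1's `transport_eq_transport_symm` —, same end values, and the contour read on the box is admissible).
[cite: Balaban1983RegularityDecay, (1.9) p.573 «U(A(Γ_{x,x′}))»] -/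
theorem term_le_holderQ_box {α : ℝ} {μ : Fin (d + 1)} {x x' : ↥(fineDom ((ℓ + 1) ^ j.k) (boxLabels j.Ms j.o))}
    {l : List ↥(fineDom ((ℓ + 1) ^ j.k) (boxLabels j.Ms j.o))} (hl : TAdm j.P μ x x' l)
    (hclose : ∀ ν, 2 * (((d : ℝ) + 1) * tnorm ((ℓ + 1) ^ j.k) j.P (x'.1 - x.1)) < per ((ℓ + 1) ^ j.k) j.P ν)
    (v : ↥(fineDom ((ℓ + 1) ^ j.k) (boxLabels j.Ms j.o)) × ι → ℝ) :
    twt j.P α x x' * siteNorm (transport (fieldLink F j.toInst.κ fun a b : ↥(fineDom ((ℓ + 1) ^ j.k) (boxLabels j.Ms j.o)) =>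
        torBond ((ℓ + 1) ^ j.k) j.P j.Ac a.1 b.1) x l *ᵥ fld v x' - fld v x)
      ≤ j.boxI.holderQ F α μ (v ∘ ⇑(eBι (ι := ι) ℓ j.k j.Ms j.o)) ((eBquiv ℓ j.k j.Ms j.o).symm x)
          ((eBquiv ℓ j.k j.Ms j.o).symm x') := by
  have hadm := j.adm_symm_of_tAdm hl hclose
  have key := le_holderQ_box j.boxI F (α := α) (v ∘ ⇑(eBι (ι := ι) ℓ j.k j.Ms j.o)) hadm
  have htr := transport_eq_transport_symm ℓ j.k j.Ms j.o F j.h3 j.hΩP j.hwrap j.toInst.κ j.Ac x l hl.2.2.2.1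
  have hA : fieldLink F j.boxI.κ j.boxI.AΩ = fieldLink F j.toInst.κ (fun a b : ↥(Box d ℓ j.k j.Ms) =>
      compField (shiftF ℓ j.k j.o (perField ((ℓ + 1) ^ j.k) j.P j.Ac)) a.1 b.1) := by
    rw [AΩ_boxI]
  rw [hA, j.fld_comp_symm, j.fld_comp_symm, ← htr, j.wt_symm_eq_twt hl hclose] at key
  exact key

omit [Fintype ι] [DecidableEq ι] in
/-- **AN ADMISSIBLE TORUS CONTOUR OF `Ω` IS AN ADMISSIBLE TORUS CONTOUR OF `T_η`** (same points; `Ω ⊂ T_η`).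
[cite: Balaban1983RegularityDecay, p.573 «Γ_{x,x′} … contour», (1.11) p.573] -/
theorem tAdm_inclT {μ : Fin (d + 1)} {x x' : ↥(fineDom ((ℓ + 1) ^ j.k) (boxLabels j.Ms j.o))}
    {l : List ↥(fineDom ((ℓ + 1) ^ j.k) (boxLabels j.Ms j.o))} (hl : TAdm j.P μ x x' l) :
    TAdm j.P μ (j.inclT x) (j.inclT x') (l.map j.inclT) := by
  obtain ⟨hbx, hbx', hne, hpath, hend, hlen, hball⟩ := hl
  refine ⟨?_, ?_, ?_, ?_, ?_, ?_, ?_⟩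
  · rw [inclT_val]; exact fineDom_mono j.hn j.hΩP hbx
  · rw [inclT_val]; exact fineDom_mono j.hn j.hΩP hbx'
  · rw [inclT_val, inclT_val]; exact hne
  · refine pathRel_map (r := fun u v : ↥(fineDom ((ℓ + 1) ^ j.k) (boxLabels j.Ms j.o)) =>
      TNbr ((ℓ + 1) ^ j.k) j.P u.1 v.1) j.inclT (fun u v huv => ?_) x l hpath
    show TNbr _ _ (j.inclT u).1 (j.inclT v).1
    rw [inclT_val, inclT_val]; exact huv
  · rw [pathEnd_map, hend]
  · rw [List.length_map, inclT_val, inclT_val]; exact hlen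
  · intro z' hz'
    obtain ⟨z, hz, rfl⟩ := List.mem_map.1 hz'
    rw [inclT_val, inclT_val, inclT_val]; exact hball z hz

omit [Fintype ι] [DecidableEq ι] in
/-- the weight does not see the inclusion. [cite: Balaban1983RegularityDecay, (1.9) p.573, dictionary] -/
theorem twt_inclT (α : ℝ) (x x' : ↥(fineDom ((ℓ + 1) ^ j.k) (boxLabels j.Ms j.o))) :
    twt j.P α (j.inclT x) (j.inclT x') = twt j.P α x x' := by
  unfold twt; rw [inclT_val, inclT_val]

/-- the transporter of a contour of `Ω` computed with the torus links of `T_η` along the inclusion is the transporter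
computed in `Ω` (same bonds, same field). [cite: Balaban1983RegularityDecay, (1.4) p.572 «U(A(Γ))», dictionary] -/
theorem transport_inclT (κ : ℝ) (x : ↥(fineDom ((ℓ + 1) ^ j.k) (boxLabels j.Ms j.o)))
    (l : List ↥(fineDom ((ℓ + 1) ^ j.k) (boxLabels j.Ms j.o))) :
    transport (fieldLink F κ fun a b : ↥(fineDom ((ℓ + 1) ^ j.k) (boxDom j.P)) =>
        torBond ((ℓ + 1) ^ j.k) j.P j.Ac a.1 b.1) (j.inclT x) (l.map j.inclT)
      = transport (fieldLink F κ fun a b : ↥(fineDom ((ℓ + 1) ^ j.k) (boxLabels j.Ms j.o)) =>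
          torBond ((ℓ + 1) ^ j.k) j.P j.Ac a.1 b.1) x l := by
  have hW : (fun a b : ↥(fineDom ((ℓ + 1) ^ j.k) (boxLabels j.Ms j.o)) =>
      fieldLink F κ (fun u v : ↥(fineDom ((ℓ + 1) ^ j.k) (boxDom j.P)) => torBond ((ℓ + 1) ^ j.k) j.P j.Ac u.1 v.1)
        (j.inclT a) (j.inclT b))
      = fieldLink F κ (fun a b : ↥(fineDom ((ℓ + 1) ^ j.k) (boxLabels j.Ms j.o)) =>
          torBond ((ℓ + 1) ^ j.k) j.P j.Ac a.1 b.1) := by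
    funext a b
    show F.U (κ * torBond _ j.P j.Ac (j.inclT a).1 (j.inclT b).1) = F.U (κ * torBond _ j.P j.Ac a.1 b.1)
    rw [inclT_val, inclT_val]
  rw [transport_map, hW]

end Contours

/-! ## §4. The constants of the assembled estimate and their bookkeeping -/

section Constants

/-- half the smaller decay rate: `δ₀ := min(δ_T, δ_B)/2` (the factor (1.12) near `∂Ω` costs half the rate).
[cite: Balaban1983RegularityDecay, (1.12) p.573, dictionary] -/
def dHalf (δT δB : ℝ) : ℝ := min δT δB / 2

/-- the constant of the one-point `δG` members near `∂Ω`: `(c_B + c_T)·e^{min(δ_T,δ_B)R₀}`. [cite: Balaban1983RegularityDecay, (1.11)–(1.12) p.573, dictionary] -/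
def cNear (cT cB δT δB RT : ℝ) : ℝ := (cB + cT) * Real.exp (min δT δB * RT)

/-- the constant of the assembled Theorem on proper parallelepipeds of the torus:
`(4(d+1)c_B + c_T + 2·cNear)·e^{δ₀(1 + 2R₀)}`. [cite: Balaban1983RegularityDecay, Theorem p.573, dictionary] -/
def cAll (d : ℕ) (cT cB δT δB RT : ℝ) : ℝ :=
  (4 * ((d : ℝ) + 1) * cB + cT + 2 * cNear cT cB δT δB RT) * Real.exp (dHalf δT δB * (1 + 2 * RT))

variable {cT cB δT δB RT : ℝ} (hδT : 0 < δT) (hcT : 0 < cT) (hδB : 0 < δB) (hcB : 0 < cB) (hRT : 0 < RT)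

omit [Fintype ι] [DecidableEq ι] in
include hδT hδB in
/-- `δ₀ > 0`. [cite: Balaban1983RegularityDecay, Theorem p.573, dictionary] -/
theorem dHalf_pos : 0 < dHalf δT δB := by unfold dHalf; have := lt_min hδT hδB; positivity

omit [Fintype ι] [DecidableEq ι] in
/-- `2δ₀ = min(δ_T, δ_B)`. [cite: Balaban1983RegularityDecay, Theorem p.573, dictionary] -/
theorem two_mul_dHalf : 2 * dHalf δT δB = min δT δB := by unfold dHalf; ring

omit [Fintype ι] [DecidableEq ι] in
include hδT hδB in
/-- `δ₀ ≤ δ_T`, `δ₀ ≤ δ_B`, `δ₀ ≤ min`. [cite: Balaban1983RegularityDecay, Theorem p.573, dictionary] -/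
theorem dHalf_le : dHalf δT δB ≤ δT ∧ dHalf δT δB ≤ δB ∧ dHalf δT δB ≤ min δT δB := by
  have h0 := (lt_min hδT hδB).le
  have h1 := min_le_left δT δB
  have h2 := min_le_right δT δB
  unfold dHalf
  exact ⟨by linarith, by linarith, by linarith⟩

omit [Fintype ι] [DecidableEq ι] in
include hδT hcT hδB hcB hRT in
/-- `cNear > 0`, `c_T ≤ cNear`, `c_B ≤ cNear`. [cite: Balaban1983RegularityDecay, Theorem p.573, dictionary] -/
theorem cNear_bounds : 0 < cNear cT cB δT δB RT ∧ cT ≤ cNear cT cB δT δB RT ∧ cB ≤ cNear cT cB δT δB RT := by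
  have h1 : 1 ≤ Real.exp (min δT δB * RT) := Real.one_le_exp (mul_nonneg (lt_min hδT hδB).le hRT.le)
  unfold cNear
  refine ⟨by positivity, ?_, ?_⟩ <;> nlinarith

omit [Fintype ι] [DecidableEq ι] in
include hδT hcT hδB hcB hRT in
/-- `cAll > 0` and the comparisons used by the members: `c_B`, `4(d+1)c_B`, `cNear`, `c_T`, `2·cNear·e^{δ₀R₀}`,
`(4(d+1)c_B + c_T)·e^{δ₀(1+2R₀)}` are all `≤ cAll`. [cite: Balaban1983RegularityDecay, Theorem p.573, dictionary] -/
theorem cAll_bounds : 0 < cAll d cT cB δT δB RT ∧ cB ≤ cAll d cT cB δT δB RT ∧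
    4 * ((d : ℝ) + 1) * cB ≤ cAll d cT cB δT δB RT ∧ cNear cT cB δT δB RT ≤ cAll d cT cB δT δB RT ∧
    cT ≤ cAll d cT cB δT δB RT ∧
    2 * cNear cT cB δT δB RT * Real.exp (dHalf δT δB * RT) ≤ cAll d cT cB δT δB RT ∧
    (4 * ((d : ℝ) + 1) * cB + cT) * Real.exp (dHalf δT δB * (1 + 2 * RT)) ≤ cAll d cT cB δT δB RT := by
  obtain ⟨hN0, hTN, hBN⟩ := cNear_bounds hδT hcT hδB hcB hRT
  have hδ0 : 0 ≤ dHalf δT δB := (dHalf_pos hδT hδB).le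
  have hE1 : 1 ≤ Real.exp (dHalf δT δB * (1 + 2 * RT)) := Real.one_le_exp (by positivity)
  have hE2 : Real.exp (dHalf δT δB * RT) ≤ Real.exp (dHalf δT δB * (1 + 2 * RT)) :=
    Real.exp_le_exp.2 (by nlinarith)
  have hd : (0 : ℝ) ≤ d := Nat.cast_nonneg d
  unfold cAll
  set S : ℝ := 4 * ((d : ℝ) + 1) * cB + cT + 2 * cNear cT cB δT δB RT with hS
  set E : ℝ := Real.exp (dHalf δT δB * (1 + 2 * RT)) with hE
  have hS0 : 0 ≤ S := by positivity
  have hSE : S ≤ S * E := by nlinarith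
  refine ⟨by positivity, ?_, ?_, ?_, ?_, ?_, ?_⟩
  · nlinarith
  · nlinarith
  · nlinarith
  · nlinarith
  · calc 2 * cNear cT cB δT δB RT * Real.exp (dHalf δT δB * RT) ≤ S * E :=
          mul_le_mul (by nlinarith) hE2 (Real.exp_pos _).le hS0
      _ = S * E := rfl
  · exact mul_le_mul_of_nonneg_right (by nlinarith) (Real.exp_pos _).le

omit [Fintype ι] [DecidableEq ι] in
/-- monotonicity of the right-hand side of (1.10) in the constant and the rate. [cite: Balaban1983RegularityDecay, (1.10) p.573, dictionary] -/
theorem rhs_le {c c' δ δ' s s' N : ℝ} (hc : c ≤ c') (hc0 : 0 ≤ c) (hδ : δ' ≤ δ) (hδ0 : 0 ≤ δ') (hs : s' ≤ s)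
    (hs0 : 0 ≤ s') (hN : 0 ≤ N) :
    c * Real.exp (-(δ * s)) * N ≤ c' * Real.exp (-(δ' * s')) * N := by
  have h1 : Real.exp (-(δ * s)) ≤ Real.exp (-(δ' * s')) :=
    Real.exp_le_exp.2 (by nlinarith [mul_le_mul_of_nonneg_right hδ hs0, mul_le_mul_of_nonneg_left hs (hδ0.trans hδ)])
  exact mul_le_mul_of_nonneg_right (mul_le_mul hc h1 (Real.exp_pos _).le (hc0.trans hc)) hN

omit [Fintype ι] [DecidableEq ι] in
/-- monotonicity of the right-hand side of (1.11)–(1.12). [cite: Balaban1983RegularityDecay, (1.12) p.573, dictionary] -/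
theorem rhs_le₂ {c c' δ δ' s s' b b' t N : ℝ} (hc : c ≤ c') (hc0 : 0 ≤ c) (hδ : δ' ≤ δ) (hδ0 : 0 ≤ δ')
    (hs : s' ≤ s) (hs0 : 0 ≤ s') (hb : b' ≤ b) (hb0 : 0 ≤ b') (ht0 : 0 ≤ t) (hN : 0 ≤ N) :
    c * Real.exp (-(δ * s)) * Real.exp (-(δ * b + δ * t)) * N
      ≤ c' * Real.exp (-(δ' * s')) * Real.exp (-(δ' * b' + δ' * t)) * N := by
  have h1 : Real.exp (-(δ * s)) ≤ Real.exp (-(δ' * s')) :=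
    Real.exp_le_exp.2 (by nlinarith [mul_le_mul_of_nonneg_right hδ hs0, mul_le_mul_of_nonneg_left hs (hδ0.trans hδ)])
  have h2 : Real.exp (-(δ * b + δ * t)) ≤ Real.exp (-(δ' * b' + δ' * t)) :=
    Real.exp_le_exp.2 (by nlinarith [mul_le_mul_of_nonneg_right hδ hb0, mul_le_mul_of_nonneg_left hb (hδ0.trans hδ),
      mul_le_mul_of_nonneg_right hδ ht0])
  refine mul_le_mul_of_nonneg_right ?_ hN
  exact mul_le_mul (mul_le_mul hc h1 (Real.exp_pos _).le (hc0.trans hc)) h2 (Real.exp_pos _).le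
    (mul_nonneg (hc0.trans hc) (Real.exp_pos _).le)

omit [Fintype ι] [DecidableEq ι] in
include hδT hcT hδB hcB in
/-- **THE `δG` ONE-POINT BOUND NEAR `∂Ω`**: from `A ≤ c_B e^{−δ_B s}N + c_T e^{−δ_T s}N`, `dist_T(supp f, Ω^c) ≤ s + t`
and `t ≤ R₀` one gets the printed shape with the factor (1.12) at rate `δ₀` and constant `cNear`.
[cite: Balaban1983RegularityDecay, (1.11)–(1.12) p.573] -/
theorem near_bound {A s t bS N : ℝ} (hA : A ≤ cB * Real.exp (-(δB * s)) * N + cT * Real.exp (-(δT * s)) * N)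
    (hs0 : 0 ≤ s) (hN : 0 ≤ N) (hbS : bS ≤ s + t) (ht : t ≤ RT) :
    A ≤ cNear cT cB δT δB RT * Real.exp (-(dHalf δT δB * s)) *
      Real.exp (-(dHalf δT δB * t + dHalf δT δB * bS)) * N := by
  have hδ0 := (dHalf_pos hδT hδB).le
  have h1 : Real.exp (-(δB * s)) ≤ Real.exp (-(2 * dHalf δT δB * s)) :=
    Real.exp_le_exp.2 (by rw [two_mul_dHalf]; nlinarith [min_le_right δT δB])
  have h2 : Real.exp (-(δT * s)) ≤ Real.exp (-(2 * dHalf δT δB * s)) :=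
    Real.exp_le_exp.2 (by rw [two_mul_dHalf]; nlinarith [min_le_left δT δB])
  have h3 : A ≤ (cB + cT) * Real.exp (-(2 * dHalf δT δB * s)) * N := by
    have := add_le_add (mul_le_mul_of_nonneg_right (mul_le_mul_of_nonneg_left h1 hcB.le) hN)
      (mul_le_mul_of_nonneg_right (mul_le_mul_of_nonneg_left h2 hcT.le) hN)
    linarith
  have h4 := exp_factor_split (δ := dHalf δT δB) (s := s) (t := t) (t' := t) (u := 0) (bS := bS) (R := RT) hδ0
    (by linarith) ht ht
  have h5 : Real.exp (dHalf δT δB * (0 + 2 * RT)) = Real.exp (min δT δB * RT) := by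
    rw [← two_mul_dHalf]; congr 1; ring
  rw [h5] at h4
  calc A ≤ (cB + cT) * Real.exp (-(2 * dHalf δT δB * s)) * N := h3
    _ ≤ (cB + cT) * (Real.exp (min δT δB * RT) * Real.exp (-(dHalf δT δB * s)) *
          Real.exp (-(dHalf δT δB * t + dHalf δT δB * bS))) * N :=
        mul_le_mul_of_nonneg_right (mul_le_mul_of_nonneg_left h4 (by positivity)) hN
    _ = _ := by unfold cNear; ring

omit [Fintype ι] [DecidableEq ι] in
include hδT hcT hδB hcB hRT in
/-- the restricted `δG` one-point bound of r01, weakened to rate `δ₀` and constant `cNear`.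
[cite: Balaban1983RegularityDecay, (1.11)–(1.12) p.573] -/
theorem far_bound {A s t bS N : ℝ}
    (hA : A ≤ cT * Real.exp (-(δT * s)) * Real.exp (-(δT * t + δT * bS)) * N)
    (hs0 : 0 ≤ s) (ht0 : 0 ≤ t) (hbS0 : 0 ≤ bS) (hN : 0 ≤ N) :
    A ≤ cNear cT cB δT δB RT * Real.exp (-(dHalf δT δB * s)) *
      Real.exp (-(dHalf δT δB * t + dHalf δT δB * bS)) * N := by
  obtain ⟨hN0, hTN, -⟩ := cNear_bounds hδT hcT hδB hcB hRT
  obtain ⟨hl, -, -⟩ := dHalf_le hδT hδB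
  exact hA.trans (rhs_le₂ hTN hcT.le hl (dHalf_pos hδT hδB).le le_rfl hs0 le_rfl ht0 hbS0 hN)

omit [Fintype ι] [DecidableEq ι] in
include hδT hcT hδB hcB hRT in
/-- the restricted `δG` two-point bound of r01, weakened to rate `δ₀` and constant `cAll`.
[cite: Balaban1983RegularityDecay, (1.11)–(1.12) p.573] -/
theorem far_bound₂ {A m b bS N : ℝ}
    (hA : A ≤ cT * Real.exp (-(δT * m)) * Real.exp (-(δT * b + δT * bS)) * N)
    (hm0 : 0 ≤ m) (hb0 : 0 ≤ b) (hbS0 : 0 ≤ bS) (hN : 0 ≤ N) :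
    A ≤ cAll d cT cB δT δB RT * Real.exp (-(dHalf δT δB * m)) *
      Real.exp (-(dHalf δT δB * b + dHalf δT δB * bS)) * N := by
  obtain ⟨-, -, -, -, hT, -, -⟩ := cAll_bounds (d := d) hδT hcT hδB hcB hRT
  obtain ⟨hl, -, -⟩ := dHalf_le hδT hδB
  exact hA.trans (rhs_le₂ hT hcT.le hl (dHalf_pos hδT hδB).le le_rfl hm0 le_rfl hb0 hbS0 hN)

omit [Fintype ι] [DecidableEq ι] in
include hδT hcT hδB hcB hRT in
/-- **THE `δG` HÖLDER BOUND AT PAIRS AT LEAST ONE UNIT APART**: the sum of the two one-point bounds (rate `δ₀`,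
constant `cNear`) is dominated by the printed two-point shape with constant `cAll` when `min dist_T(·,Ω^c) ≤ R₀`.
[cite: Balaban1983RegularityDecay, (1.11)–(1.12) p.573] -/
theorem unitfar_bound {A X X' s s' t t' bS N : ℝ} (hA : A ≤ X' + X)
    (hX : X ≤ cNear cT cB δT δB RT * Real.exp (-(dHalf δT δB * s)) *
      Real.exp (-(dHalf δT δB * t + dHalf δT δB * bS)) * N)
    (hX' : X' ≤ cNear cT cB δT δB RT * Real.exp (-(dHalf δT δB * s')) *
      Real.exp (-(dHalf δT δB * t' + dHalf δT δB * bS)) * N)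
    (ht0 : 0 ≤ t) (ht'0 : 0 ≤ t') (hb : min t t' ≤ RT) (hN : 0 ≤ N) :
    A ≤ cAll d cT cB δT δB RT * Real.exp (-(dHalf δT δB * min s s')) *
      Real.exp (-(dHalf δT δB * min t t' + dHalf δT δB * bS)) * N := by
  obtain ⟨hN0, -, -⟩ := cNear_bounds hδT hcT hδB hcB hRT
  obtain ⟨-, -, -, -, -, h6, -⟩ := cAll_bounds (d := d) hδT hcT hδB hcB hRT
  have hδ0 := (dHalf_pos hδT hδB).le
  set δ := dHalf δT δB
  set C := cNear cT cB δT δB RT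
  -- each one-point bound ≤ C e^{−δ m} e^{−δ bS} N
  have hE : ∀ {u v : ℝ}, min s s' ≤ u → 0 ≤ v →
      C * Real.exp (-(δ * u)) * Real.exp (-(δ * v + δ * bS)) * N
        ≤ C * Real.exp (-(δ * min s s')) * Real.exp (-(δ * bS)) * N := by
    intro u v hu hv
    refine mul_le_mul_of_nonneg_right ?_ hN
    refine mul_le_mul (mul_le_mul_of_nonneg_left (Real.exp_le_exp.2 (by nlinarith)) hN0.le)
      (Real.exp_le_exp.2 (by nlinarith)) (Real.exp_pos _).le (by positivity)
  have h1 := hX.trans (hE (min_le_left _ _) ht0)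
  have h2 := hX'.trans (hE (min_le_right _ _) ht'0)
  -- e^{−δ bS} ≤ e^{δ R} e^{−(δ min t t' + δ bS)}
  have h3 : Real.exp (-(δ * bS)) ≤ Real.exp (δ * RT) * Real.exp (-(δ * min t t' + δ * bS)) := by
    rw [← Real.exp_add]; exact Real.exp_le_exp.2 (by nlinarith)
  calc A ≤ 2 * C * Real.exp (-(δ * min s s')) * Real.exp (-(δ * bS)) * N := by linarith
    _ ≤ 2 * C * Real.exp (-(δ * min s s')) * (Real.exp (δ * RT) * Real.exp (-(δ * min t t' + δ * bS))) * N :=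
        mul_le_mul_of_nonneg_right (mul_le_mul_of_nonneg_left h3 (by positivity)) hN
    _ = (2 * C * Real.exp (δ * RT)) * Real.exp (-(δ * min s s')) * Real.exp (-(δ * min t t' + δ * bS)) * N := by ring
    _ ≤ _ := by
        refine mul_le_mul_of_nonneg_right (mul_le_mul_of_nonneg_right
          (mul_le_mul_of_nonneg_right h6 (Real.exp_pos _).le) (Real.exp_pos _).le) hN

omit [Fintype ι] [DecidableEq ι] in
include hδT hcT hδB hcB hRT in
/-- **THE `δG` HÖLDER BOUND AT PAIRS CLOSER THAN ONE UNIT**: from the split bound `A ≤ 4(d+1)(c_B e^{−δ_B m}N) +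
c_T e^{−δ_T m}N`, `dist_T(supp f, Ω^c) ≤ m + b + 1` and `b ≤ R₀`, the printed two-point shape with constant `cAll`.
[cite: Balaban1983RegularityDecay, (1.11)–(1.12) p.573] -/
theorem unitnear_bound {A m b bS N : ℝ}
    (hA : A ≤ 4 * ((d : ℝ) + 1) * (cB * Real.exp (-(δB * m)) * N) + cT * Real.exp (-(δT * m)) * N)
    (hm0 : 0 ≤ m) (hN : 0 ≤ N) (hbS : bS ≤ m + b + 1) (hb : b ≤ RT) :
    A ≤ cAll d cT cB δT δB RT * Real.exp (-(dHalf δT δB * m)) *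
      Real.exp (-(dHalf δT δB * b + dHalf δT δB * bS)) * N := by
  obtain ⟨-, -, -, -, -, -, h7⟩ := cAll_bounds (d := d) hδT hcT hδB hcB hRT
  have hδ0 := (dHalf_pos hδT hδB).le
  have hd : (0 : ℝ) ≤ d := Nat.cast_nonneg d
  have h1 : Real.exp (-(δB * m)) ≤ Real.exp (-(2 * dHalf δT δB * m)) :=
    Real.exp_le_exp.2 (by rw [two_mul_dHalf]; nlinarith [min_le_right δT δB])
  have h2 : Real.exp (-(δT * m)) ≤ Real.exp (-(2 * dHalf δT δB * m)) :=
    Real.exp_le_exp.2 (by rw [two_mul_dHalf]; nlinarith [min_le_left δT δB])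
  have h3 : A ≤ (4 * ((d : ℝ) + 1) * cB + cT) * Real.exp (-(2 * dHalf δT δB * m)) * N := by
    have e1 := mul_le_mul_of_nonneg_right (mul_le_mul_of_nonneg_left h1 hcB.le) hN
    have e2 := mul_le_mul_of_nonneg_right (mul_le_mul_of_nonneg_left h2 hcT.le) hN
    nlinarith
  have h4 := exp_factor_split (δ := dHalf δT δB) (s := m) (t := b) (t' := b) (u := 1) (bS := bS) (R := RT) hδ0
    (by linarith) hb hb
  calc A ≤ (4 * ((d : ℝ) + 1) * cB + cT) * Real.exp (-(2 * dHalf δT δB * m)) * N := h3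
    _ ≤ (4 * ((d : ℝ) + 1) * cB + cT) * (Real.exp (dHalf δT δB * (1 + 2 * RT)) * Real.exp (-(dHalf δT δB * m)) *
          Real.exp (-(dHalf δT δB * b + dHalf δT δB * bS))) * N :=
        mul_le_mul_of_nonneg_right (mul_le_mul_of_nonneg_left h4 (by positivity)) hN
    _ = ((4 * ((d : ℝ) + 1) * cB + cT) * Real.exp (dHalf δT δB * (1 + 2 * RT))) * Real.exp (-(dHalf δT δB * m)) *
          Real.exp (-(dHalf δT δB * b + dHalf δT δB * bS)) * N := by ring
    _ ≤ _ := mul_le_mul_of_nonneg_right (mul_le_mul_of_nonneg_right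
          (mul_le_mul_of_nonneg_right h7 (Real.exp_pos _).le) (Real.exp_pos _).le) hN

end Constants

/-! ## §5. The six members on a proper parallelepiped of the torus -/

section Members

variable {ℓ : ℕ} {amin aplus m2plus : ℝ} (j : TorusBoxInst d ℓ amin aplus m2plus) (F : OrthFlow ι)
  {creg β : ℝ} {K K' : ℕ} {α δT cT RT δB cB RB : ℝ}

/-! ### The conclusions of the two lineage Theorems, read in the letters of this file -/

/-- box (1.10), value, at every site of `Ω̃` (r04: `rect := True`). [cite: Balaban1983RegularityDecay, (1.10) p.573] -/
theorem box_valG (HB : Ineq19_110 (boxPairFamNC F d ℓ amin aplus m2plus creg β K' j.boxI) α δB cB RB)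
    (g : ↥(Box d ℓ j.k j.Ms) × ι → ℝ) (z : ↥(Box d ℓ j.k j.Ms)) :
    siteNorm (fld (j.boxI.GΩ F *ᵥ g) z) ≤ cB * Real.exp (-(δB * j.boxI.sdist1 z g)) * supN g :=
  (HB.2 (0 : Fin (d + 1)) g z (Or.inl trivial)).2

/-- box (1.10), derivative, at every site of `Ω̃`. [cite: Balaban1983RegularityDecay, (1.10) p.573] -/
theorem box_valDG (HB : Ineq19_110 (boxPairFamNC F d ℓ amin aplus m2plus creg β K' j.boxI) α δB cB RB)
    (μ : Fin (d + 1)) (g : ↥(Box d ℓ j.k j.Ms) × ι → ℝ) (z : ↥(Box d ℓ j.k j.Ms)) :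
    siteNorm (fld (j.boxI.DΩ F μ *ᵥ (j.boxI.GΩ F *ᵥ g)) z) ≤ cB * Real.exp (-(δB * j.boxI.sdist1 z g)) * supN g :=
  (HB.2 μ g z (Or.inl trivial)).1

/-- box (1.9) at every pair of `Ω̃`. [cite: Balaban1983RegularityDecay, (1.9) p.573] -/
theorem box_lhs19 (HB : Ineq19_110 (boxPairFamNC F d ℓ amin aplus m2plus creg β K' j.boxI) α δB cB RB)
    (μ : Fin (d + 1)) (g : ↥(Box d ℓ j.k j.Ms) × ι → ℝ) (z z' : ↥(Box d ℓ j.k j.Ms)) :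
    j.boxI.holderQ F α μ (j.boxI.DΩ F μ *ᵥ (j.boxI.GΩ F *ᵥ g)) z z'
      ≤ cB * Real.exp (-(δB * min (j.boxI.sdist1 z g) (j.boxI.sdist1 z' g))) * supN g :=
  HB.1 μ g z z' (Or.inl trivial)

/-- full torus (1.10), value, at every site (r01: `rect` holds on `T_η`). [cite: Balaban1983RegularityDecay, (1.10) p.573, p.572 «a torus T_η»] -/
theorem full_valG (HF : Ineq19_110 (torusPairFam F d ℓ amin aplus m2plus creg β K j.full) α δT cT RT)
    (g : ↥(fineDom ((ℓ + 1) ^ j.k) (boxDom j.P)) × ι → ℝ) (w : ↥(fineDom ((ℓ + 1) ^ j.k) (boxDom j.P))) :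
    siteNorm (fld (j.full.GT F *ᵥ g) w) ≤ cT * Real.exp (-(δT * tsdist1 j.P w g)) * supN g :=
  (HF.2 (0 : Fin (d + 1)) g w (Or.inl j.rect_full)).2

/-- full torus (1.10), derivative, at every site. [cite: Balaban1983RegularityDecay, (1.10) p.573, p.572 «a torus T_η»] -/
theorem full_valDG (HF : Ineq19_110 (torusPairFam F d ℓ amin aplus m2plus creg β K j.full) α δT cT RT)
    (μ : Fin (d + 1)) (g : ↥(fineDom ((ℓ + 1) ^ j.k) (boxDom j.P)) × ι → ℝ)
    (w : ↥(fineDom ((ℓ + 1) ^ j.k) (boxDom j.P))) :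
    siteNorm (fld (j.full.DT F μ *ᵥ (j.full.GT F *ᵥ g)) w) ≤ cT * Real.exp (-(δT * tsdist1 j.P w g)) * supN g :=
  (HF.2 μ g w (Or.inl j.rect_full)).1

/-- full torus (1.9) at every pair. [cite: Balaban1983RegularityDecay, (1.9) p.573, p.572 «a torus T_η»] -/
theorem full_lhs19 (HF : Ineq19_110 (torusPairFam F d ℓ amin aplus m2plus creg β K j.full) α δT cT RT)
    (μ : Fin (d + 1)) (g : ↥(fineDom ((ℓ + 1) ^ j.k) (boxDom j.P)) × ι → ℝ)
    (w w' : ↥(fineDom ((ℓ + 1) ^ j.k) (boxDom j.P))) :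
    tholderQ j.P F j.full.κ j.Ac α μ (j.full.DT F μ *ᵥ (j.full.GT F *ᵥ g)) w w'
      ≤ cT * Real.exp (-(δT * min (tsdist1 j.P w g) (tsdist1 j.P w' g))) * supN g :=
  HF.1 μ g w w' (Or.inl j.rect_full)

/-- torus pair `Ω ⊂ T_η`, (1.11)–(1.12) value member, r01's restricted clause. [cite: Balaban1983RegularityDecay, (1.11)–(1.12) p.573] -/
theorem tor_dvalG (HT : Ineq111_112 (torusPairFam F d ℓ amin aplus m2plus creg β K j.toInst) α δT cT RT)
    (f : ↥(fineDom ((ℓ + 1) ^ j.k) (boxLabels j.Ms j.o)) × ι → ℝ) (x : ↥(fineDom ((ℓ + 1) ^ j.k) (boxLabels j.Ms j.o)))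
    (hx : RT ≤ tcdist j.P x) :
    siteNorm (fld (j.toInst.deltaT F f) x) ≤ cT * Real.exp (-(δT * tsdist1 j.P x f))
      * Real.exp (-(δT * tcdist j.P x + δT * tbdistS j.P f)) * supN f :=
  (HT.2 (0 : Fin (d + 1)) f x (Or.inr hx)).2

/-- torus pair, (1.11)–(1.12) derivative member, r01's restricted clause. [cite: Balaban1983RegularityDecay, (1.11)–(1.12) p.573] -/
theorem tor_dvalDG (HT : Ineq111_112 (torusPairFam F d ℓ amin aplus m2plus creg β K j.toInst) α δT cT RT)
    (μ : Fin (d + 1)) (f : ↥(fineDom ((ℓ + 1) ^ j.k) (boxLabels j.Ms j.o)) × ι → ℝ)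
    (x : ↥(fineDom ((ℓ + 1) ^ j.k) (boxLabels j.Ms j.o))) (hx : RT ≤ tcdist j.P x) :
    siteNorm (fld (j.toInst.DT F μ *ᵥ j.toInst.deltaT F f) x) ≤ cT * Real.exp (-(δT * tsdist1 j.P x f))
      * Real.exp (-(δT * tcdist j.P x + δT * tbdistS j.P f)) * supN f :=
  (HT.2 μ f x (Or.inr hx)).1

/-- torus pair, (1.11)–(1.12) Hölder member, r01's restricted clause. [cite: Balaban1983RegularityDecay, (1.11)–(1.12) p.573] -/
theorem tor_dlhs19 (HT : Ineq111_112 (torusPairFam F d ℓ amin aplus m2plus creg β K j.toInst) α δT cT RT)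
    (μ : Fin (d + 1)) (f : ↥(fineDom ((ℓ + 1) ^ j.k) (boxLabels j.Ms j.o)) × ι → ℝ)
    (x x' : ↥(fineDom ((ℓ + 1) ^ j.k) (boxLabels j.Ms j.o))) (hxx : RT ≤ min (tcdist j.P x) (tcdist j.P x')) :
    tholderQ j.P F j.toInst.κ j.Ac α μ (j.toInst.DT F μ *ᵥ j.toInst.deltaT F f) x x'
      ≤ cT * Real.exp (-(δT * min (tsdist1 j.P x f) (tsdist1 j.P x' f)))
        * Real.exp (-(δT * min (tcdist j.P x) (tcdist j.P x') + δT * tbdistS j.P f)) * supN f :=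
  HT.1 μ f x x' (Or.inr hxx)

/-! ### (1.9)–(1.10) on `Ω` without restriction -/

variable (hα0 : 0 ≤ α) (hα1 : α ≤ 1) (hδT : 0 < δT) (hcT : 0 < cT) (hδB : 0 < δB) (hcB : 0 < cB) (hRT : 0 < RT)

include hδB hcB in
/-- **(1.10), VALUE, AT EVERY SITE OF A PROPER PARALLELEPIPED OF THE TORUS**:
`|(G_k(Ω,A)f)(x)| ≤ c_B e^{−δ_B dist_T(x, supp f)}‖f‖_∞` (the box Theorem along the chart; torus distances never exceed
lattice ones). [cite: Balaban1983RegularityDecay, (1.10) p.573 «for rectangular parallelepipeds … without any restrictions»] -/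
theorem valG_Ω (HB : Ineq19_110 (boxPairFamNC F d ℓ amin aplus m2plus creg β K' j.boxI) α δB cB RB)
    (f : ↥(fineDom ((ℓ + 1) ^ j.k) (boxLabels j.Ms j.o)) × ι → ℝ) (x : ↥(fineDom ((ℓ + 1) ^ j.k) (boxLabels j.Ms j.o))) :
    siteNorm (fld (j.toInst.GT F *ᵥ f) x) ≤ cB * Real.exp (-(δB * tsdist1 j.P x f)) * supN f := by
  obtain ⟨a, rfl⟩ := eB_surjective ℓ j.k j.Ms j.o x
  rw [j.fld_GT_eB F f a]
  refine (j.box_valG F HB _ a).trans ?_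
  rw [supN_comp_eBι]
  exact decay_mono hcB.le hδB.le (j.tsdist1_le_sdist1 f a) le_rfl (supN_nonneg f)

include hδB hcB in
/-- **(1.10), DERIVATIVE, AT EVERY SITE OF A PROPER PARALLELEPIPED OF THE TORUS.** [cite: Balaban1983RegularityDecay, (1.10) p.573 «for rectangular parallelepipeds … without any restrictions»] -/
theorem valDG_Ω (HB : Ineq19_110 (boxPairFamNC F d ℓ amin aplus m2plus creg β K' j.boxI) α δB cB RB)
    (μ : Fin (d + 1)) (f : ↥(fineDom ((ℓ + 1) ^ j.k) (boxLabels j.Ms j.o)) × ι → ℝ)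
    (x : ↥(fineDom ((ℓ + 1) ^ j.k) (boxLabels j.Ms j.o))) :
    siteNorm (fld (j.toInst.DT F μ *ᵥ (j.toInst.GT F *ᵥ f)) x) ≤ cB * Real.exp (-(δB * tsdist1 j.P x f)) * supN f := by
  obtain ⟨a, rfl⟩ := eB_surjective ℓ j.k j.Ms j.o x
  rw [j.fld_DT_GT_eB F μ f a]
  refine (j.box_valDG F HB μ _ a).trans ?_
  rw [supN_comp_eBι]
  exact decay_mono hcB.le hδB.le (j.tsdist1_le_sdist1 f a) le_rfl (supN_nonneg f)

include hα0 hα1 hδB hcB in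
/-- **THE HÖLDER TERM OF `D_μG_k(Ω,A)f` ALONG EVERY ADMISSIBLE TORUS CONTOUR OF `Ω`**, `≤ 4(d+1)c_B e^{−δ_B m}‖f‖_∞`:
close pairs through the box family's `holderQ` (the contour read on the box is admissible, same weight and transporter),
far pairs by r01's `holder_far` with two one-point derivative bounds. [cite: Balaban1983RegularityDecay, (1.9) p.573 «Γ_{x,x′} denotes a shortest contour»] -/
theorem holder_term_Ω (HB : Ineq19_110 (boxPairFamNC F d ℓ amin aplus m2plus creg β K' j.boxI) α δB cB RB)
    {μ : Fin (d + 1)} (f : ↥(fineDom ((ℓ + 1) ^ j.k) (boxLabels j.Ms j.o)) × ι → ℝ)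
    {x x' : ↥(fineDom ((ℓ + 1) ^ j.k) (boxLabels j.Ms j.o))} {l : List ↥(fineDom ((ℓ + 1) ^ j.k) (boxLabels j.Ms j.o))}
    (hl : TAdm j.P μ x x' l) :
    twt j.P α x x' * siteNorm (transport (fieldLink F j.toInst.κ fun a b : ↥(fineDom ((ℓ + 1) ^ j.k) (boxLabels j.Ms j.o)) =>
        torBond ((ℓ + 1) ^ j.k) j.P j.Ac a.1 b.1) x l *ᵥ fld (j.toInst.DT F μ *ᵥ (j.toInst.GT F *ᵥ f)) x'
        - fld (j.toInst.DT F μ *ᵥ (j.toInst.GT F *ᵥ f)) x)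
      ≤ 4 * ((d : ℝ) + 1) * (cB * Real.exp (-(δB * min (tsdist1 j.P x f) (tsdist1 j.P x' f))) * supN f) := by
  have hd : (0 : ℝ) ≤ d := Nat.cast_nonneg d
  have hb0 : 0 ≤ cB * Real.exp (-(δB * min (tsdist1 j.P x f) (tsdist1 j.P x' f))) * supN f := by
    have := supN_nonneg f; positivity
  by_cases hclose : ∀ ν, 2 * (((d : ℝ) + 1) * tnorm ((ℓ + 1) ^ j.k) j.P (x'.1 - x.1)) < per ((ℓ + 1) ^ j.k) j.P ν
  · -- close pairs: through the box family's `holderQ`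
    have h1 := j.term_le_holderQ_box F (α := α) hl hclose (j.toInst.DT F μ *ᵥ (j.toInst.GT F *ᵥ f))
    rw [j.DTGT_comp_eBι F μ f] at h1
    have h2 := j.box_lhs19 F HB μ (f ∘ ⇑(eBι (ι := ι) ℓ j.k j.Ms j.o)) ((eBquiv ℓ j.k j.Ms j.o).symm x)
      ((eBquiv ℓ j.k j.Ms j.o).symm x')
    have hsd : ∀ y : ↥(fineDom ((ℓ + 1) ^ j.k) (boxLabels j.Ms j.o)),
        tsdist1 j.P y f ≤ j.boxI.sdist1 ((eBquiv ℓ j.k j.Ms j.o).symm y) (f ∘ ⇑(eBι (ι := ι) ℓ j.k j.Ms j.o)) := by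
      intro y
      have := j.tsdist1_le_sdist1 f ((eBquiv ℓ j.k j.Ms j.o).symm y)
      rwa [← eBquiv_apply, Equiv.apply_symm_apply] at this
    have hmin : min (tsdist1 j.P x f) (tsdist1 j.P x' f)
        ≤ min (j.boxI.sdist1 ((eBquiv ℓ j.k j.Ms j.o).symm x) (f ∘ ⇑(eBι (ι := ι) ℓ j.k j.Ms j.o)))
            (j.boxI.sdist1 ((eBquiv ℓ j.k j.Ms j.o).symm x') (f ∘ ⇑(eBι (ι := ι) ℓ j.k j.Ms j.o))) :=
      min_le_min (hsd x) (hsd x')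
    calc _ ≤ _ := h1
      _ ≤ _ := h2
      _ ≤ cB * Real.exp (-(δB * min (tsdist1 j.P x f) (tsdist1 j.P x' f))) * supN f := by
          rw [supN_comp_eBι]; exact decay_mono hcB.le hδB.le hmin le_rfl (supN_nonneg f)
      _ ≤ _ := le_mul_of_one_le_left hb0 (by nlinarith)
  · -- far pairs: r01's `holder_far`
    have hm0 := min_le_left (tsdist1 j.P x f) (tsdist1 j.P x' f)
    have hm1 := min_le_right (tsdist1 j.P x f) (tsdist1 j.P x' f)
    have hVx := (j.valDG_Ω F hδB hcB HB μ f x).trans (decay_mono hcB.le hδB.le hm0 le_rfl (supN_nonneg f))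
    have hVx' := (j.valDG_Ω F hδB hcB HB μ f x').trans (decay_mono hcB.le hδB.le hm1 le_rfl (supN_nonneg f))
    exact holder_far j.toInst F hα0 hα1 l hclose _ hVx hVx'

include hα0 hα1 hδB hcB in
/-- **(1.9) AT EVERY PAIR OF A PROPER PARALLELEPIPED OF THE TORUS**, constant `4(d+1)c_B`.
[cite: Balaban1983RegularityDecay, (1.9) p.573 «for rectangular parallelepipeds … without any restrictions»] -/
theorem lhs19_Ω (HB : Ineq19_110 (boxPairFamNC F d ℓ amin aplus m2plus creg β K' j.boxI) α δB cB RB)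
    (μ : Fin (d + 1)) (f : ↥(fineDom ((ℓ + 1) ^ j.k) (boxLabels j.Ms j.o)) × ι → ℝ)
    (x x' : ↥(fineDom ((ℓ + 1) ^ j.k) (boxLabels j.Ms j.o))) :
    tholderQ j.P F j.toInst.κ j.Ac α μ (j.toInst.DT F μ *ᵥ (j.toInst.GT F *ᵥ f)) x x'
      ≤ 4 * ((d : ℝ) + 1) * (cB * Real.exp (-(δB * min (tsdist1 j.P x f) (tsdist1 j.P x' f))) * supN f) := by
  have hd : (0 : ℝ) ≤ d := Nat.cast_nonneg d
  have := supN_nonneg f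
  exact tholderQ_le j.P F j.toInst.κ j.Ac (by positivity) fun l hl => j.holder_term_Ω F hα0 hα1 hδB hcB HB f hl

/-! ### (1.11)–(1.12) on `(Ω, T_η)` without restriction -/

include hδT hcT hδB hcB hRT in
/-- **(1.11)–(1.12), VALUE, AT EVERY SITE**: far from `∂Ω` r01's clause; within `R₀` of `∂Ω` the split
`δGf = G_k(Ω,A)f − (G_k(T_η,A)Ef)|Ω` (both unrestricted) with the factor (1.12) from
`dist_T(supp f, Ω^c) ≤ dist_T(x, supp f) + dist_T(x, Ω^c)`. [cite: Balaban1983RegularityDecay, (1.11)–(1.12) p.573 «for rectangular parallelepipeds … without any restrictions»] -/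
theorem dvalG_all (HT : Ineq111_112 (torusPairFam F d ℓ amin aplus m2plus creg β K j.toInst) α δT cT RT)
    (HF : Ineq19_110 (torusPairFam F d ℓ amin aplus m2plus creg β K j.full) α δT cT RT)
    (HB : Ineq19_110 (boxPairFamNC F d ℓ amin aplus m2plus creg β K' j.boxI) α δB cB RB)
    (f : ↥(fineDom ((ℓ + 1) ^ j.k) (boxLabels j.Ms j.o)) × ι → ℝ) (x : ↥(fineDom ((ℓ + 1) ^ j.k) (boxLabels j.Ms j.o))) :
    siteNorm (fld (j.toInst.deltaT F f) x) ≤ cNear cT cB δT δB RT * Real.exp (-(dHalf δT δB * tsdist1 j.P x f)) *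
      Real.exp (-(dHalf δT δB * tcdist j.P x + dHalf δT δB * tbdistS j.P f)) * supN f := by
  by_cases hfar : RT ≤ tcdist j.P x
  · exact far_bound hδT hcT hδB hcB hRT (j.tor_dvalG F HT f x hfar) (tsdist1_nonneg j.P x f) (tcdist_nonneg j.P x)
      (tbdistS_nonneg j.P f) (supN_nonneg f)
  · have hfar' : tcdist j.P x ≤ RT := (not_le.1 hfar).le
    refine near_bound hδT hcT hδB hcB ?_ (tsdist1_nonneg j.P x f) (supN_nonneg f)
      (tbdistS_le_tsdist1_add_tcdist j.hn j.P j.hP f x) hfar'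
    have h1 := j.valG_Ω F hδB hcB HB f x
    have h2 := j.full_valG F HF (j.toInst.extT f) (j.inclT x)
    rw [j.tsdist1_extT, j.supN_extT] at h2
    rw [j.toInst.fld_deltaT F f x]
    exact (siteNorm_sub_le _ _).trans (add_le_add h1 h2)

include hδT hcT hδB hcB hRT in
/-- **(1.11)–(1.12), DERIVATIVE, AT EVERY SITE** (same mechanism on a bond of `Ω`; off the bonds of `Ω` the Neumann
derivative vanishes). [cite: Balaban1983RegularityDecay, (1.11)–(1.12) p.573 «for rectangular parallelepipeds … without any restrictions»] -/
theorem dvalDG_all (HT : Ineq111_112 (torusPairFam F d ℓ amin aplus m2plus creg β K j.toInst) α δT cT RT)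
    (HF : Ineq19_110 (torusPairFam F d ℓ amin aplus m2plus creg β K j.full) α δT cT RT)
    (HB : Ineq19_110 (boxPairFamNC F d ℓ amin aplus m2plus creg β K' j.boxI) α δB cB RB)
    (μ : Fin (d + 1)) (f : ↥(fineDom ((ℓ + 1) ^ j.k) (boxLabels j.Ms j.o)) × ι → ℝ)
    (x : ↥(fineDom ((ℓ + 1) ^ j.k) (boxLabels j.Ms j.o))) :
    siteNorm (fld (j.toInst.DT F μ *ᵥ j.toInst.deltaT F f) x) ≤ cNear cT cB δT δB RT *
      Real.exp (-(dHalf δT δB * tsdist1 j.P x f)) *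
      Real.exp (-(dHalf δT δB * tcdist j.P x + dHalf δT δB * tbdistS j.P f)) * supN f := by
  by_cases hfar : RT ≤ tcdist j.P x
  · exact far_bound hδT hcT hδB hcB hRT (j.tor_dvalDG F HT μ f x hfar) (tsdist1_nonneg j.P x f) (tcdist_nonneg j.P x)
      (tbdistS_nonneg j.P f) (supN_nonneg f)
  · have hfar' : tcdist j.P x ≤ RT := (not_le.1 hfar).le
    refine near_bound hδT hcT hδB hcB ?_ (tsdist1_nonneg j.P x f) (supN_nonneg f)
      (tbdistS_le_tsdist1_add_tcdist j.hn j.P j.hP f x) hfar'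
    by_cases hxμ : twrap ((ℓ + 1) ^ j.k) j.P (x.1 + e1 μ) ∈ fineDom ((ℓ + 1) ^ j.k) (boxLabels j.Ms j.o)
    · have h1 := j.valDG_Ω F hδB hcB HB μ f x
      have h2 := j.full_valDG F HF μ (j.toInst.extT f) (j.inclT x)
      rw [j.tsdist1_extT, j.supN_extT] at h2
      rw [j.toInst.fld_DT_deltaT F μ f x hxμ]
      exact (siteNorm_sub_le _ _).trans (add_le_add h1 h2)
    · rw [j.toInst.fld_DT_of_not_mem F μ _ x hxμ, siteNorm_zero]
      have := supN_nonneg f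
      positivity

include hα0 hα1 hδT hcT hδB hcB hRT in
/-- **(1.11)–(1.12), HÖLDER MEMBER, AT EVERY PAIR** of a proper parallelepiped of the torus: far from `∂Ω` r01's
clause; within `R₀` of `∂Ω`, pairs at least one unit apart by the two one-point derivative bounds (weight `≤ 1`), closer
pairs by the split `D_μδGf = D_μG_k(Ω,A)f − (D_μG_k(T_η,A)Ef)|Ω` along every admissible contour (the `Ω`-term by
`holder_term_Ω`, the `T_η`-term through the inclusion and r01's unrestricted (1.9) on the full torus).
[cite: Balaban1983RegularityDecay, (1.11)–(1.12) p.573 «for rectangular parallelepipeds … without any restrictions»] -/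
theorem dlhs19_all (HT : Ineq111_112 (torusPairFam F d ℓ amin aplus m2plus creg β K j.toInst) α δT cT RT)
    (HF : Ineq19_110 (torusPairFam F d ℓ amin aplus m2plus creg β K j.full) α δT cT RT)
    (HB : Ineq19_110 (boxPairFamNC F d ℓ amin aplus m2plus creg β K' j.boxI) α δB cB RB)
    (μ : Fin (d + 1)) (f : ↥(fineDom ((ℓ + 1) ^ j.k) (boxLabels j.Ms j.o)) × ι → ℝ)
    (x x' : ↥(fineDom ((ℓ + 1) ^ j.k) (boxLabels j.Ms j.o))) :
    tholderQ j.P F j.toInst.κ j.Ac α μ (j.toInst.DT F μ *ᵥ j.toInst.deltaT F f) x x'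
      ≤ cAll d cT cB δT δB RT * Real.exp (-(dHalf δT δB * min (tsdist1 j.P x f) (tsdist1 j.P x' f))) *
        Real.exp (-(dHalf δT δB * min (tcdist j.P x) (tcdist j.P x') + dHalf δT δB * tbdistS j.P f)) * supN f := by
  have hd : (0 : ℝ) ≤ d := Nat.cast_nonneg d
  have hN := supN_nonneg f
  have hm0 : 0 ≤ min (tsdist1 j.P x f) (tsdist1 j.P x' f) := le_min (tsdist1_nonneg j.P x f) (tsdist1_nonneg j.P x' f)
  have hb0 : 0 ≤ min (tcdist j.P x) (tcdist j.P x') := le_min (tcdist_nonneg j.P x) (tcdist_nonneg j.P x')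
  have hbS0 := tbdistS_nonneg j.P f
  by_cases hfar : RT ≤ min (tcdist j.P x) (tcdist j.P x')
  · exact far_bound₂ hδT hcT hδB hcB hRT (j.tor_dlhs19 F HT μ f x x' hfar) hm0 hb0 hbS0 hN
  have hfar' : min (tcdist j.P x) (tcdist j.P x') ≤ RT := (not_le.1 hfar).le
  obtain ⟨hC0, -, -, -, -, -, -⟩ := cAll_bounds (d := d) hδT hcT hδB hcB hRT
  refine tholderQ_le j.P F j.toInst.κ j.Ac (by positivity) fun l hl => ?_
  set V := j.toInst.DT F μ *ᵥ j.toInst.deltaT F f with hV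
  by_cases hnear : tnorm ((ℓ + 1) ^ j.k) j.P (x'.1 - x.1) < (((ℓ + 1) ^ j.k : ℕ) : ℝ)
  · -- pairs closer than one unit: split along the contour
    have hbx := hl.1
    have hbx' := hl.2.1
    have hvx : fld V x = fld (j.toInst.DT F μ *ᵥ (j.toInst.GT F *ᵥ f)) x
        - fld (j.toInst.D₀T F μ *ᵥ (j.toInst.G₀T F *ᵥ j.toInst.extT f)) (j.inclT x) :=
      j.toInst.fld_DT_deltaT F μ f x hbx
    have hvx' : fld V x' = fld (j.toInst.DT F μ *ᵥ (j.toInst.GT F *ᵥ f)) x'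
        - fld (j.toInst.D₀T F μ *ᵥ (j.toInst.G₀T F *ᵥ j.toInst.extT f)) (j.inclT x') :=
      j.toInst.fld_DT_deltaT F μ f x' hbx'
    set W := transport (fieldLink F j.toInst.κ fun a b : ↥(fineDom ((ℓ + 1) ^ j.k) (boxLabels j.Ms j.o)) =>
        torBond ((ℓ + 1) ^ j.k) j.P j.Ac a.1 b.1) x l with hW
    set v₁ := j.toInst.DT F μ *ᵥ (j.toInst.GT F *ᵥ f) with hv₁
    set v₂ := j.toInst.D₀T F μ *ᵥ (j.toInst.G₀T F *ᵥ j.toInst.extT f) with hv₂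
    have hsplit : W *ᵥ fld V x' - fld V x
        = (W *ᵥ fld v₁ x' - fld v₁ x) - (W *ᵥ fld v₂ (j.inclT x') - fld v₂ (j.inclT x)) := by
      rw [hvx, hvx', Matrix.mulVec_sub]; abel
    have hw0 : 0 ≤ twt j.P α x x' := Real.rpow_nonneg (div_nonneg (Nat.cast_nonneg _) (tnorm_nonneg _ _ _)) _
    -- the Ω-term
    have hA := j.holder_term_Ω F hα0 hα1 hδB hcB HB (μ := μ) f hl
    -- the T_η-term through the inclusion
    have hadmT := j.tAdm_inclT hl
    have hB := (le_tholderQ j.P F j.full.κ j.Ac v₂ hadmT).trans (j.full_lhs19 F HF μ (j.toInst.extT f) (j.inclT x)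
      (j.inclT x'))
    rw [j.twt_inclT, j.transport_inclT, j.tsdist1_extT, j.tsdist1_extT, j.supN_extT] at hB
    have hsum : twt j.P α x x' * siteNorm (W *ᵥ fld V x' - fld V x)
        ≤ 4 * ((d : ℝ) + 1) * (cB * Real.exp (-(δB * min (tsdist1 j.P x f) (tsdist1 j.P x' f))) * supN f)
          + cT * Real.exp (-(δT * min (tsdist1 j.P x f) (tsdist1 j.P x' f))) * supN f := by
      rw [hsplit]
      calc twt j.P α x x' * siteNorm ((W *ᵥ fld v₁ x' - fld v₁ x) - (W *ᵥ fld v₂ (j.inclT x') - fld v₂ (j.inclT x)))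
          ≤ twt j.P α x x' * (siteNorm (W *ᵥ fld v₁ x' - fld v₁ x)
              + siteNorm (W *ᵥ fld v₂ (j.inclT x') - fld v₂ (j.inclT x))) :=
            mul_le_mul_of_nonneg_left (siteNorm_sub_le _ _) hw0
        _ ≤ _ := by rw [mul_add]; exact add_le_add hA hB
    -- the factor (1.12): `bS ≤ m + b + 1`
    have hs1 : tsdist1 j.P x f ≤ tsdist1 j.P x' f + 1 := by
      have h := tsdist1_le_tsdist1_add j.hn j.P j.hP f x x'
      rw [tnorm_sub_rev j.hn j.hP x.1 x'.1] at h
      have : tnorm ((ℓ + 1) ^ j.k) j.P (x'.1 - x.1) / (((ℓ + 1) ^ j.k : ℕ) : ℝ) ≤ 1 := by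
        rw [div_le_one j.n_pos]; exact hnear.le
      linarith only [h, this]
    have hs2 : tsdist1 j.P x' f ≤ tsdist1 j.P x f + 1 := by
      have h := tsdist1_le_tsdist1_add j.hn j.P j.hP f x' x
      have : tnorm ((ℓ + 1) ^ j.k) j.P (x'.1 - x.1) / (((ℓ + 1) ^ j.k : ℕ) : ℝ) ≤ 1 := by
        rw [div_le_one j.n_pos]; exact hnear.le
      linarith only [h, this]
    have hbS : tbdistS j.P f ≤ min (tsdist1 j.P x f) (tsdist1 j.P x' f) + min (tcdist j.P x) (tcdist j.P x') + 1 := by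
      have e1 := tbdistS_le_tsdist1_add_tcdist j.hn j.P j.hP f x
      have e2 := tbdistS_le_tsdist1_add_tcdist j.hn j.P j.hP f x'
      have hm1 : tsdist1 j.P x f - 1 ≤ min (tsdist1 j.P x f) (tsdist1 j.P x' f) :=
        le_min (by linarith only) (by linarith only [hs1])
      have hm2 : tsdist1 j.P x' f - 1 ≤ min (tsdist1 j.P x f) (tsdist1 j.P x' f) :=
        le_min (by linarith only [hs2]) (by linarith only)
      rcases min_choice (tcdist j.P x) (tcdist j.P x') with hmin | hmin <;> rw [hmin]
      · linarith only [e1, hm1]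
      · linarith only [e2, hm2]
    exact unitnear_bound hδT hcT hδB hcB hRT hsum hm0 hN hbS hfar'
  · -- pairs at least one unit apart: weight ≤ 1, two one-point bounds
    have hn' : (((ℓ + 1) ^ j.k : ℕ) : ℝ) ≤ tnorm ((ℓ + 1) ^ j.k) j.P (x'.1 - x.1) := not_lt.1 hnear
    have hTpos : 0 < tnorm ((ℓ + 1) ^ j.k) j.P (x'.1 - x.1) := lt_of_lt_of_le j.n_pos hn'
    have hw1 : twt j.P α x x' ≤ 1 := by
      unfold twt
      exact Real.rpow_le_one (div_nonneg (Nat.cast_nonneg _) hTpos.le) ((div_le_one hTpos).2 hn') hα0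
    have hterm : twt j.P α x x' * siteNorm (transport (fieldLink F j.toInst.κ fun a b :
        ↥(fineDom ((ℓ + 1) ^ j.k) (boxLabels j.Ms j.o)) => torBond ((ℓ + 1) ^ j.k) j.P j.Ac a.1 b.1) x l
          *ᵥ fld V x' - fld V x) ≤ siteNorm (fld V x') + siteNorm (fld V x) := by
      have h := siteNorm_transport_sub_le F j.toInst.κ (fun a b : ↥(fineDom ((ℓ + 1) ^ j.k) (boxLabels j.Ms j.o)) =>
        torBond ((ℓ + 1) ^ j.k) j.P j.Ac a.1 b.1) x l (fld V x') (fld V x)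
      have h0 : 0 ≤ siteNorm (fld V x') + siteNorm (fld V x) := add_nonneg (siteNorm_nonneg _) (siteNorm_nonneg _)
      calc _ ≤ 1 * (siteNorm (fld V x') + siteNorm (fld V x)) :=
            mul_le_mul hw1 h (siteNorm_nonneg _) zero_le_one
        _ = _ := one_mul _
    exact unitfar_bound hδT hcT hδB hcB hRT hterm (j.dvalDG_all F hδT hcT hδB hcB hRT HT HF HB μ f x)
      (j.dvalDG_all F hδT hcT hδB hcB hRT HT HF HB μ f x') (tcdist_nonneg j.P x) (tcdist_nonneg j.P x') hfar' hN

end Members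

end TorusBoxInst

/-! ## §6. The Theorem on the family of proper parallelepipeds of the torus -/

section Assembly

section Packaging

variable {ℓ : ℕ} {amin aplus m2plus : ℝ} (j : TorusBoxInst d ℓ amin aplus m2plus) (F : OrthFlow ι)
  {creg β : ℝ} {K K' : ℕ} {α δT cT RT δB cB RB : ℝ}
  (hα0 : 0 ≤ α) (hα1 : α ≤ 1) (hδT : 0 < δT) (hcT : 0 < cT) (hδB : 0 < δB) (hcB : 0 < cB) (hRT : 0 < RT)

include hα0 hα1 hδT hcT hδB hcB hRT in
/-- **(1.9)–(1.10) FOR THE NEW FAMILY AT ONE INSTANCE**, constants `(δ₀, c₀, R₀) = (dHalf, cAll, R_T)`, from the box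
Theorem's conclusion at `boxI`. [cite: Balaban1983RegularityDecay, Theorem (1.9)–(1.10) p.573 «without any restrictions on the points x, x′»] -/
theorem ineq19_110_torusBoxFam
    (HB : Ineq19_110 (boxPairFamNC F d ℓ amin aplus m2plus creg β K' j.boxI) α δB cB RB) :
    Ineq19_110 (torusBoxFam F d ℓ amin aplus m2plus creg β K K' j) α (TorusBoxInst.dHalf δT δB)
      (TorusBoxInst.cAll d cT cB δT δB RT) RT := by
  obtain ⟨hC0, hC1, hC3, -, -, -, -⟩ := TorusBoxInst.cAll_bounds (d := d) hδT hcT hδB hcB hRT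
  obtain ⟨-, hdr, -⟩ := TorusBoxInst.dHalf_le hδT hδB
  have hδ0 := (TorusBoxInst.dHalf_pos hδT hδB).le
  have hd0 : (0 : ℝ) ≤ d := Nat.cast_nonneg d
  refine ⟨fun μ f x x' _ => ?_, fun μ f x _ => ⟨?_, ?_⟩⟩
  · -- (1.9)
    have h := (j.lhs19_Ω F hα0 hα1 hδB hcB HB μ f x x').trans_eq
      (show 4 * ((d : ℝ) + 1) * (cB * Real.exp (-(δB * min (tsdist1 j.P x f) (tsdist1 j.P x' f))) * supN f)
        = (4 * ((d : ℝ) + 1) * cB) * Real.exp (-(δB * min (tsdist1 j.P x f) (tsdist1 j.P x' f))) * supN f by ring)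
    exact h.trans (TorusBoxInst.rhs_le hC3 (by positivity) hdr hδ0 le_rfl
      (le_min (tsdist1_nonneg j.P x f) (tsdist1_nonneg j.P x' f)) (supN_nonneg f))
  · -- (1.10), derivative
    exact (j.valDG_Ω F hδB hcB HB μ f x).trans
      (TorusBoxInst.rhs_le hC1 hcB.le hdr hδ0 le_rfl (tsdist1_nonneg j.P x f) (supN_nonneg f))
  · -- (1.10), value
    exact (j.valG_Ω F hδB hcB HB f x).trans
      (TorusBoxInst.rhs_le hC1 hcB.le hdr hδ0 le_rfl (tsdist1_nonneg j.P x f) (supN_nonneg f))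

include hα0 hα1 hδT hcT hδB hcB hRT in
/-- (1.11)–(1.12), Hölder member, for the new family at one instance, constants `(dHalf, cAll, R_T)`.
[cite: Balaban1983RegularityDecay, Theorem (1.11)–(1.12) p.573 «without any restrictions on the points x, x′»] -/
theorem fam_dlhs19
    (HT : Ineq111_112 (torusPairFam F d ℓ amin aplus m2plus creg β K j.toInst) α δT cT RT)
    (HF : Ineq19_110 (torusPairFam F d ℓ amin aplus m2plus creg β K j.full) α δT cT RT)
    (HB : Ineq19_110 (boxPairFamNC F d ℓ amin aplus m2plus creg β K' j.boxI) α δB cB RB)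
    (μ : Fin (d + 1)) (f : ↥(fineDom ((ℓ + 1) ^ j.k) (boxLabels j.Ms j.o)) × ι → ℝ)
    (x x' : ↥(fineDom ((ℓ + 1) ^ j.k) (boxLabels j.Ms j.o))) :
    (torusBoxFam F d ℓ amin aplus m2plus creg β K K' j).dlhs19 α μ f x x'
      ≤ TorusBoxInst.cAll d cT cB δT δB RT
        * Real.exp (-(TorusBoxInst.dHalf δT δB * (torusBoxFam F d ℓ amin aplus m2plus creg β K K' j).sdist2 x x' f))
        * Real.exp (-(TorusBoxInst.dHalf δT δB * (torusBoxFam F d ℓ amin aplus m2plus creg β K K' j).bdist2 x x'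
            + TorusBoxInst.dHalf δT δB * (torusBoxFam F d ℓ amin aplus m2plus creg β K K' j).bdistS f))
        * (torusBoxFam F d ℓ amin aplus m2plus creg β K K' j).supNorm f :=
  j.dlhs19_all F hα0 hα1 hδT hcT hδB hcB hRT HT HF HB μ f x x'

include hδT hcT hδB hcB hRT in
/-- (1.11)–(1.12), derivative member, for the new family at one instance. [cite: Balaban1983RegularityDecay, Theorem (1.11)–(1.12) p.573 «without any restrictions on the points x, x′»] -/
theorem fam_dvalDG
    (HT : Ineq111_112 (torusPairFam F d ℓ amin aplus m2plus creg β K j.toInst) α δT cT RT)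
    (HF : Ineq19_110 (torusPairFam F d ℓ amin aplus m2plus creg β K j.full) α δT cT RT)
    (HB : Ineq19_110 (boxPairFamNC F d ℓ amin aplus m2plus creg β K' j.boxI) α δB cB RB)
    (μ : Fin (d + 1)) (f : ↥(fineDom ((ℓ + 1) ^ j.k) (boxLabels j.Ms j.o)) × ι → ℝ)
    (x : ↥(fineDom ((ℓ + 1) ^ j.k) (boxLabels j.Ms j.o))) :
    (torusBoxFam F d ℓ amin aplus m2plus creg β K K' j).dvalDG μ f x
      ≤ TorusBoxInst.cAll d cT cB δT δB RT
        * Real.exp (-(TorusBoxInst.dHalf δT δB * (torusBoxFam F d ℓ amin aplus m2plus creg β K K' j).sdist1 x f))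
        * Real.exp (-(TorusBoxInst.dHalf δT δB * (torusBoxFam F d ℓ amin aplus m2plus creg β K K' j).bdist1 x
            + TorusBoxInst.dHalf δT δB * (torusBoxFam F d ℓ amin aplus m2plus creg β K K' j).bdistS f))
        * (torusBoxFam F d ℓ amin aplus m2plus creg β K K' j).supNorm f := by
  obtain ⟨-, -, -, hC4, -, -, -⟩ := TorusBoxInst.cAll_bounds (d := d) hδT hcT hδB hcB hRT
  obtain ⟨hN0, -, -⟩ := TorusBoxInst.cNear_bounds hδT hcT hδB hcB hRT
  exact (j.dvalDG_all F hδT hcT hδB hcB hRT HT HF HB μ f x).trans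
    (TorusBoxInst.rhs_le₂ hC4 hN0.le le_rfl (TorusBoxInst.dHalf_pos hδT hδB).le le_rfl (tsdist1_nonneg j.P x f)
      le_rfl (tcdist_nonneg j.P x) (tbdistS_nonneg j.P f) (supN_nonneg f))

include hδT hcT hδB hcB hRT in
/-- (1.11)–(1.12), value member, for the new family at one instance. [cite: Balaban1983RegularityDecay, Theorem (1.11)–(1.12) p.573 «without any restrictions on the points x, x′»] -/
theorem fam_dvalG
    (HT : Ineq111_112 (torusPairFam F d ℓ amin aplus m2plus creg β K j.toInst) α δT cT RT)
    (HF : Ineq19_110 (torusPairFam F d ℓ amin aplus m2plus creg β K j.full) α δT cT RT)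
    (HB : Ineq19_110 (boxPairFamNC F d ℓ amin aplus m2plus creg β K' j.boxI) α δB cB RB)
    (f : ↥(fineDom ((ℓ + 1) ^ j.k) (boxLabels j.Ms j.o)) × ι → ℝ) (x : ↥(fineDom ((ℓ + 1) ^ j.k) (boxLabels j.Ms j.o))) :
    (torusBoxFam F d ℓ amin aplus m2plus creg β K K' j).dvalG f x
      ≤ TorusBoxInst.cAll d cT cB δT δB RT
        * Real.exp (-(TorusBoxInst.dHalf δT δB * (torusBoxFam F d ℓ amin aplus m2plus creg β K K' j).sdist1 x f))
        * Real.exp (-(TorusBoxInst.dHalf δT δB * (torusBoxFam F d ℓ amin aplus m2plus creg β K K' j).bdist1 x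
            + TorusBoxInst.dHalf δT δB * (torusBoxFam F d ℓ amin aplus m2plus creg β K K' j).bdistS f))
        * (torusBoxFam F d ℓ amin aplus m2plus creg β K K' j).supNorm f := by
  obtain ⟨-, -, -, hC4, -, -, -⟩ := TorusBoxInst.cAll_bounds (d := d) hδT hcT hδB hcB hRT
  obtain ⟨hN0, -, -⟩ := TorusBoxInst.cNear_bounds hδT hcT hδB hcB hRT
  exact (j.dvalG_all F hδT hcT hδB hcB hRT HT HF HB f x).trans
    (TorusBoxInst.rhs_le₂ hC4 hN0.le le_rfl (TorusBoxInst.dHalf_pos hδT hδB).le le_rfl (tsdist1_nonneg j.P x f)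
      le_rfl (tcdist_nonneg j.P x) (tbdistS_nonneg j.P f) (supN_nonneg f))

include hα0 hα1 hδT hcT hδB hcB hRT in
/-- **(1.11)–(1.12) FOR THE NEW FAMILY AT ONE INSTANCE**, constants `(dHalf, cAll, R_T)`, from the torus Theorem's
conclusions at `toInst` and `full` and the box Theorem's at `boxI`. [cite: Balaban1983RegularityDecay, Theorem (1.11)–(1.12) p.573 «without any restrictions on the points x, x′»] -/
theorem ineq111_112_torusBoxFam
    (HT : Ineq111_112 (torusPairFam F d ℓ amin aplus m2plus creg β K j.toInst) α δT cT RT)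
    (HF : Ineq19_110 (torusPairFam F d ℓ amin aplus m2plus creg β K j.full) α δT cT RT)
    (HB : Ineq19_110 (boxPairFamNC F d ℓ amin aplus m2plus creg β K' j.boxI) α δB cB RB) :
    Ineq111_112 (torusBoxFam F d ℓ amin aplus m2plus creg β K K' j) α (TorusBoxInst.dHalf δT δB)
      (TorusBoxInst.cAll d cT cB δT δB RT) RT :=
  ⟨fun μ f x x' _ => fam_dlhs19 j F hα0 hα1 hδT hcT hδB hcB hRT HT HF HB μ f x x',
    fun μ f x _ => ⟨fam_dvalDG j F hδT hcT hδB hcB hRT HT HF HB μ f x, fam_dvalG j F hδT hcT hδB hcB hRT HT HF HB f x⟩⟩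

end Packaging

/-- **THEOREM p. 573, (1.9)–(1.12), «WITHOUT ANY RESTRICTIONS ON THE POINTS x, x′», ON THE FAMILY OF PROPER
PARALLELEPIPEDS OF THE TORUS** (`Ω` = the unit blocks with labels in a box `o + Π[0,Ms)`, `Ms_ν + 1 ≤ P_ν`, inside
`Ω₀ = T_η`; (1.7)-regular torus field; the typed `η`-uniform form `ThmPrintedNN` of pv17 with `rect := True`): for every
`α ∈ [0,1)` ONE `(δ₀, c₀, R₀, e₁)` — `δ₀ = min(δ_T, δ_B)/2`, `c₀ = cAll`, `e₁ = min(e_T, e_B)` from r01's torus Theorem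
(`thmPrintedNN_torusPairFam`, modulus `Kmod`) and r04∕p17's box Theorem (`thmPrintedNN_boxPairFamNC`, modulus `KmodNC`)
— such that every instance with big blocks and `0 < e ≤ e₁` satisfies (1.9)–(1.12) at ALL points `x, x′ ∈ Ω`.
[cite: Balaban1983RegularityDecay, Theorem (1.9)–(1.12) p.573 «For some simple sets Ω, e.g. for rectangular parallelepipeds, the inequalities hold without any restrictions on the points x, x′»; p.572 «operators on subsets of a torus T_η which we identify with a rectangular parallelepiped in ηZ^d with periodic conditions»] -/
theorem thmPrintedNN_torusBoxFam (F : OrthFlow ι) {ℓ₁ : ℝ} (hℓ₁ : 0 ≤ ℓ₁)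
    (hLip : ∀ t (v : ι → ℝ), ((F.U t - 1) *ᵥ v) ⬝ᵥ ((F.U t - 1) *ᵥ v) ≤ (ℓ₁ * t) ^ 2 * (v ⬝ᵥ v))
    (d ℓ : ℕ) (hd : 1 ≤ d) (hℓ : 1 ≤ ℓ) (amin aplus m2plus : ℝ) (ha : 0 < amin) (creg β : ℝ) (hcreg : 0 ≤ creg)
    (hβ : 0 < β) :
    ThmPrintedNN (torusBoxFam F d ℓ amin aplus m2plus creg β (Kmod F hℓ₁ hLip d ℓ hℓ amin aplus m2plus ha)
      (KmodNC F hℓ₁ hLip d ℓ hd hℓ amin aplus m2plus ha)) := by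
  intro α hα0 hα1
  obtain ⟨δT, cT, RT, eT, hδT, hcT, hRT, heT, HTall⟩ :=
    thmPrintedNN_torusPairFam F hℓ₁ hLip d ℓ hℓ amin aplus m2plus ha creg β hcreg hβ α hα0 hα1
  obtain ⟨δB, cB, RB, eB', hδB, hcB, -, heB', HBall⟩ :=
    thmPrintedNN_boxPairFamNC F hℓ₁ hLip d ℓ hd hℓ amin aplus m2plus ha creg β hcreg hβ α hα0 hα1
  refine ⟨TorusBoxInst.dHalf δT δB, TorusBoxInst.cAll d cT cB δT δB RT, RT, min eT eB',
    TorusBoxInst.dHalf_pos hδT hδB, (TorusBoxInst.cAll_bounds (d := d) hδT hcT hδB hcB hRT).1, hRT,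
    lt_min heT heB', ?_⟩
  intro j hreg hbig he hle
  have HT := HTall j.toInst (j.regular_toInst F hreg) (j.bigBlocks_toInst F hbig) he (hle.trans (min_le_left _ _))
  have HF := (HTall j.full (j.regular_full F hreg) (j.bigBlocks_full F hbig) he (hle.trans (min_le_left _ _))).1
  have HB := (HBall j.boxI (j.regular_boxI F hreg) (j.bigBlocks_boxI F hbig) he (hle.trans (min_le_right _ _))).1
  exact ⟨ineq19_110_torusBoxFam j F hα0 hα1.le hδT hcT hδB hcB hRT HB,
    ineq111_112_torusBoxFam j F hα0 hα1.le hδT hcT hδB hcB hRT HT.2 HF HB⟩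


/-- **NON-VACUITY**: for every pair of moduli `K, K′ ≥ 1` and every threshold `e₁ > 0` the new family has an instance
meeting `regular ∧ bigBlocks ∧ 0 < e ≤ e₁` — e.g. the zero field on the torus with `3KK′` unit blocks per direction at
scale `k = 1`, `Ω` the parallelepiped of `KK′` blocks per direction at the corner `0` (vacuity standard Q-N00-6).
[cite: Balaban1983RegularityDecay, Theorem p.573 «for e sufficiently small» (non-vacuity bookkeeping)] -/
theorem hypotheses_met (F : OrthFlow ι) (d ℓ : ℕ) {amin aplus m2plus : ℝ} (hap : amin ≤ aplus) (hm : 0 ≤ m2plus)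
    (creg β : ℝ) (hcreg : 0 ≤ creg) (K K' : ℕ) (hK : 1 ≤ K) (hK' : 1 ≤ K') (e₁ : ℝ) (he₁ : 0 < e₁) :
    ∃ j : TorusBoxInst d ℓ amin aplus m2plus,
      (torusBoxFam F d ℓ amin aplus m2plus creg β K K' j).regular ∧
      (torusBoxFam F d ℓ amin aplus m2plus creg β K K' j).bigBlocks ∧
      0 < (torusBoxFam F d ℓ amin aplus m2plus creg β K K' j).e ∧
      (torusBoxFam F d ℓ amin aplus m2plus creg β K K' j).e ≤ e₁ := by
  have hKK : 1 ≤ K * K' := Nat.one_le_iff_ne_zero.2 (Nat.mul_ne_zero (by omega) (by omega))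
  have hn1 : 1 ≤ (ℓ + 1) ^ 1 := Nat.one_le_pow _ _ (Nat.succ_pos ℓ)
  have hΩP : boxLabels (fun _ : Fin (d + 1) => K * K') 0 ⊆ boxDom (fun _ : Fin (d + 1) => 3 * (K * K')) := by
    intro y hy
    rw [mem_boxDom]
    intro i
    obtain ⟨h1, h2⟩ := (mem_boxLabels.1 hy) i
    simp only [Pi.zero_apply, zero_add] at h1 h2
    push_cast at h2 ⊢
    have hKK' : (1 : ℤ) ≤ (K : ℤ) * (K' : ℤ) := by exact_mod_cast hKK
    constructor <;> nlinarith
  let j : TorusBoxInst d ℓ amin aplus m2plus :=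
    { k := 1, hk := le_rfl, P := fun _ => 3 * (K * K'), hP := fun _ => by omega,
      h3 := fun ν => by show 3 ≤ (ℓ + 1) ^ 1 * (3 * (K * K')); nlinarith,
      Ms := fun _ => K * K', o := 0, hMs := fun _ => hKK, hΩP := hΩP, hwrap := fun _ => by omega,
      a := amin, m2 := 0, ha1 := le_rfl, ha2 := hap, hm1 := le_rfl, hm2 := hm, Ac := fun _ _ => 0, e := e₁ }
  refine ⟨j, ?_, ?_, he₁, le_rfl⟩
  · intro x _ μ ν
    simp only [j, sub_self, abs_zero]
    positivity
  · have hbox : ∀ M : ℕ, IsBlockUnion K (boxDom fun _ : Fin (d + 1) => K * M) := by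
      intro M
      rw [← fineDom_boxDom hK (fun _ : Fin (d + 1) => M)]
      exact fineDom_isBlockUnion hK _
    have hlab : boxLabels (fun _ : Fin (d + 1) => K * K') 0 = boxDom (fun _ : Fin (d + 1) => K * K') := by
      ext y
      rw [mem_boxLabels, mem_boxDom]
      simp only [Pi.zero_apply, zero_add]
    refine ⟨⟨?_, ?_, fun ν => ?_⟩, fun ν => ?_⟩
    · show IsBlockUnion K (boxDom fun _ : Fin (d + 1) => 3 * (K * K'))
      have : (fun _ : Fin (d + 1) => 3 * (K * K')) = fun _ : Fin (d + 1) => K * (3 * K') := by funext i; ring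
      rw [this]; exact hbox _
    · show IsBlockUnion K (boxLabels (fun _ : Fin (d + 1) => K * K') 0)
      rw [hlab]; exact hbox _
    · exact Dvd.intro _ (by show K * (3 * K') = 3 * (K * K'); ring)
    · exact Dvd.intro_left _ rfl

end Assembly

end

end Literature.MathematicalPhysics.QuantumFieldTheory.Balaban1983to89.B4ThmTorusBox
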